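import Literature.Computability.FineGrained.OVFromSETHParse
import Literature.Computability.FineGrained.SETHHardnessProofs
import HarnessLib

/-!
# SETH ⇒ OV (fine-grained.S09): the word-RAM program — setup, simulation of the sparsifier,
# build, emulated run of the OV algorithm

Fourth part of the proof of `ovConjectureDet_of_sethWordRAM` (R. Williams, TCS 348 (2005), §5.1,
Thm. 5.1; V. Vassilevska Williams, Proc. ICM 2018, §3, Thm. 3.1). The `k`-SAT program obtained from
a sparsifier (a multi-stack Turing machine `M`, Impagliazzo–Paturi–Zane) and a hypothetical OV
program `Mov`:

* **the build** `OVRed.Single.pre`: relocate the input (`SProg.relocate`), transcode it into the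
  machine's input string (`KSatTranscoder.transcode`), read `n` and fix the base of the region
  (`glueOps`), compute the constants (`setupP`: `h = ⌈n/2⌉`, `H = 2^h`, the gadget width
  `ℓ = ⌈n/E⌉ + 1`, `N = 2^{ℓ+h}` rows, `d = c (ℓ + h)` coordinates, `D = Cs · n` clause coordinates,
  the emulated word size `ws = kM · size |y|` by a halving loop, `V`, the bases of the stamps and
  of the machine's data), save `n` and the base (`storeOps`), simulate the sparsifier
  (`TM2Emu.simProgram`), restore `n` and the base (`reloadOps`) and recompute the constants,
  initialise the region (`OVRed.BP.initPhase`), parse the output stack into the region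
  (`OVRed.BP.parsePhase`), load the emulator's environment registers (`envOps`) and clear the
  scratch (`CliqueRed.clearRegs`);
* the read-out is `CliqueRed.post` (the OV program's answer bit);
  `OVRed.Single.reduction … = withSubrun pre lay Mov CliqueRed.post`;
* the ghost parameters `OVRed.Single.Params` of a run with all derived quantities, the side
  conditions `OVRed.Single.Params.Fits W`, the build parameters `OVRed.Single.Params.bp : BP`
  handed to the build/parse certificates with `OVRed.Single.Params.bp_OK`, and the closed-form
  final memory `OVRed.Single.Params.finMem`;
* **`OVRed.Single.Params.pre_spec`** (the build reaches `finMem` within `Tpre`),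
  `OVRed.Single.Params.reduction_outputsWithin` (the whole program outputs the OV program's answer,
  by `SProg.outputsWithin_withSubrun`).

This is the *single-instance* route (namespace `OVRed.Single`): ONE OV instance for the whole
disjunction of sparse formulas, so that the hypothesis on OV is used exactly once per input; it is
independent of the split-and-list files `OVFromSETHReductionProgram.lean` / `OVFromSETHProofs.lean`
(namespace `OVRed`, the fact `sparseKSATInRAMTime_of_ov_subquadratic`). [folklore] engineering; the
time and word-size analysis and the named fact are in `OVFromSETHDischarge.lean`.
-/

namespace Literature.Computability.FineGrained.OVRed.Single

open Cryptography Cryptography.WordRAM Cryptography.WordRAM.SProg _root_.Computability Complexity Turing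

-- The finiteness fields of a bundled `FinTM2` are instance-implicit structure fields, not global
-- instances; they are made available locally, exactly as in `SETHHardnessProofs.lean`.
attribute [local instance] Turing.FinTM2.kFin Turing.FinTM2.ΛFin Turing.FinTM2.σFin
  Turing.FinTM2.Γk₀Fin

/-! ### The code -/

/-- Setup, part 1 (from `r20 = n`, `r32 = Bv`): `h, H, ℓ, Lg, N, d, D, Hd, Nd, |y|, EX, Abase, Bbase`,
and the input of the size loop. [folklore] -/
def setupOps1 (E Cs c : ℕ) : List OpSpec := [
  (.add, r 21, r 20, im 1), (.div, r 21, r 21, im 2),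
  (.shl, r 22, im 1, r 21),
  (.add, r 23, r 20, im (E - 1)), (.div, r 23, r 23, im E), (.add, r 23, r 23, im 1),
  (.add, r 24, r 23, r 21),
  (.shl, r 25, im 1, r 24),
  (.mul, r 26, r 24, im c),
  (.mul, r 27, r 20, im Cs),
  (.mul, r 36, r 22, r 26),
  (.mul, r 37, r 25, r 26),
  (.mul, r 28, r 37, im 2), (.add, r 28, r 28, im 2),
  (.mul, r 39, r 23, im 2), (.add, r 39, r 27, r 39),
  (.add, r 34, r 32, im 3), (.add, r 35, r 34, r 37),
  (.add, r 50, r 28, im 0), (.band, r 29, im 0, im 0)]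

/-- Setup, part 2: `r29 := size r50` by halving. [folklore] -/
def sizeLoop : SProg := whilenz (r 50) (block [(.shr, r 50, r 50, im 1), (.add, r 29, r 29, im 1)])

/-- Setup, part 3: `ws := kM · size`, `Pw := 2^ws`, `V := max (Pw - 1) (max cM |y|)`, `Sv`, `Qtm`. [folklore] -/
def setup3 (kM cM : ℕ) : SProg := seqs [
  block [(.mul, r 29, r 29, im kM), (.shl, r 30, im 1, r 29), (.sub, r 31, r 30, im 1), (.lt, r 52, r 31, im cM)],
  ifz (r 52) skip (block [(.band, r 31, im cM, im cM)]),
  block [(.lt, r 52, r 31, r 28)],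
  ifz (r 52) skip (block [(.band, r 31, r 28, r 28)]),
  block [(.add, r 33, r 32, r 31), (.add, r 33, r 33, im 1), (.add, r 38, r 33, r 31), (.add, r 38, r 38, im 3)]]

/-- **The setup**: all constants of the build from `n` (register `20`) and the base of the region
(register `32`). [folklore] -/
def setupP (E Cs c kM cM : ℕ) : SProg := seqs [block (setupOps1 E Cs c), sizeLoop, setup3 kM cM]

/-- After the transcoder (`r20` = end of the string, `r21` = its length): base of the region, the
simulator's count and end registers, and `n` read back from the relocated input. [folklore] -/
def glueOps : List OpSpec := [(.add, r 32, r 20, im 0), (.add, r 10, r 21, im 0), (.add, r 11, r 20, im 0),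
  (.sub, r 52, r 20, r 21), (.sub, r 52, r 52, im 101), (.div, r 52, r 52, im 2), (.add, r 52, r 52, im 101),
  (.band, r 20, pt 52, pt 52)]

/-- Save `n` and the base just below the machine's data, and hand its base to the simulator. [folklore] -/
def storeOps : List OpSpec := [(.sub, r 52, r 38, im 2), (.band, pt 52, r 20, r 20), (.add, r 52, r 52, im 1),
  (.band, pt 52, r 32, r 32), (.add, r 4, r 38, im 0)]

/-- Restore `n` and the base after the simulation (only register `4` survives it). [folklore] -/
def reloadOps : List OpSpec := [(.sub, r 52, r 4, im 2), (.band, r 20, pt 52, pt 52), (.add, r 52, r 52, im 1),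
  (.band, r 32, pt 52, pt 52)]

/-- The emulator's environment registers: `Bv, Sv, Gv = 0, Pw`. [folklore] -/
def envOps : List OpSpec := [(.add, r 10, r 32, im 0), (.add, r 11, r 33, im 0), (.band, r 12, im 0, im 0),
  (.add, r 13, r 30, im 0)]

/-- The environment registers after the build: recompute `ws, Pw, V, Sv` from the constant registers
(the parser's certificate only guarantees those), then load `Bv, Sv, 0, Pw` into the layout. [folklore] -/
def envPhase (kM cM : ℕ) : SProg := seqs [block [(.add, r 50, r 28, im 0), (.band, r 29, im 0, im 0)],
  sizeLoop, setup3 kM cM, block envOps]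

/-- The emulator layout (as in `CliqueRed.lay`). [folklore] -/
def lay : Layout := ⟨10, 11, 12, 13, 14, 15, 16⟩

/-- The code of an input symbol of the sparsifier. [folklore] -/
noncomputable def icd (M : TM2ComputableAux Γ' Γ') (γ : Γ') : ℕ := (TM2Emu.enc M.tm).code M.tm.k₀ (M.inputAlphabet.symm γ)

/-- The five input codes handed to the transcoder. [folklore] -/
noncomputable def icodes (M : TM2ComputableAux Γ' Γ') : KSatTranscoder.Codes :=
  ⟨icd M (.bit false), icd M (.bit true), icd M .bra, icd M .ket, icd M .comma⟩

open scoped Classical in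
/-- The code of an output symbol of the sparsifier: the simulation's code of a symbol of the working
alphabet of the output stack, and the out-of-range value `γ + 1` for the (never written) others, so that
codes separate the symbols that can occur from all symbols. [folklore] -/
noncomputable def ocd (M : TM2ComputableAux Γ' Γ') (γ : Γ') : ℕ :=
  if M.outputAlphabet.symm γ ∈ TM2Emu.alphabet M.tm M.tm.k₁ then (TM2Emu.enc M.tm).code M.tm.k₁ (M.outputAlphabet.symm γ)
  else (TM2Emu.enc M.tm).γ + 1

/-- On symbols of the working alphabet, `ocd` is the simulation's code. [folklore] -/
theorem ocd_of_mem (M : TM2ComputableAux Γ' Γ') {γ : Γ'} (h : M.outputAlphabet.symm γ ∈ TM2Emu.alphabet M.tm M.tm.k₁) :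
    ocd M γ = (TM2Emu.enc M.tm).code M.tm.k₁ (M.outputAlphabet.symm γ) := by
  unfold ocd; rw [if_pos h]

/-- Every output code is at most `γ + 1`. [folklore] -/
theorem ocd_le (M : TM2ComputableAux Γ' Γ') (γ : Γ') : ocd M γ ≤ (TM2Emu.enc M.tm).γ + 1 := by
  unfold ocd
  split_ifs with h
  · exact Nat.le_succ_of_le ((TM2Emu.enc_good M.tm).code_le _ _ h)
  · exact le_rfl

/-- Every output code is positive. [folklore] -/
theorem ocd_pos (M : TM2ComputableAux Γ' Γ') (γ : Γ') : 0 < ocd M γ := by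
  unfold ocd
  split_ifs with h
  · exact (TM2Emu.enc_good M.tm).code_pos _ _ h
  · exact Nat.succ_pos _

/-- The code-level build parameters of the parser: only the machine's stack number, output-stack
index and output codes (all ghost fields trivial). [folklore] -/
noncomputable def codeBP (M : TM2ComputableAux Γ' Γ') : BP :=
  ⟨fun _ => 0, 0, 0, 0, 0, 0, 0, 0, 0, 0, (TM2Emu.enc M.tm).κ, (TM2Emu.enc M.tm).ι M.tm.k₁, [], ocd M⟩

/-- **The build** (see the module docstring). [folklore] -/
noncomputable def pre (M : TM2ComputableAux Γ' Γ') (E Cs c kM cM : ℕ) : SProg := seqs [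
  relocate, KSatTranscoder.transcode (icodes M), block glueOps, setupP E Cs c kM cM, block storeOps,
  TM2Emu.simProgram M.tm, block reloadOps, setupP E Cs c kM cM, BP.initPhase, (codeBP M).parsePhase,
  envPhase kM cM, CliqueRed.clearRegs]

/-- **The `k`-SAT program**: build, one emulated run of the OV program `Mov`, read-out. [folklore] -/
noncomputable def reduction (M : TM2ComputableAux Γ' Γ') (Mov : Program) (E Cs c kM : ℕ) : Program :=
  withSubrun (pre M E Cs c kM Mov.maxConst) lay Mov CliqueRed.post

/-- The build is query-free. [folklore] -/
theorem pre_queryFree (M : TM2ComputableAux Γ' Γ') (E Cs c kM cM : ℕ) : (pre M E Cs c kM cM).QueryFree := by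
  refine seqs_queryFree ?_
  simp only [List.mem_cons, List.not_mem_nil, or_false]
  rintro s (rfl | rfl | rfl | rfl | rfl | rfl | rfl | rfl | rfl | rfl | rfl | rfl)
  · exact relocate_queryFree
  · exact KSatTranscoder.transcode_queryFree _
  · exact block_queryFree _
  · simp [setupP, setup3, sizeLoop, seqs, QueryFree, block_queryFree]
  · exact block_queryFree _
  · exact TM2Emu.simProgram_queryFree _
  · exact block_queryFree _
  · simp [setupP, setup3, sizeLoop, seqs, QueryFree, block_queryFree]
  · exact BP.initPhase_queryFree
  · exact BP.parsePhase_queryFree _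
  · simp [envPhase, setup3, sizeLoop, seqs, QueryFree, block_queryFree]
  · exact block_queryFree _

/-- The program is deterministic. [folklore] -/
theorem reduction_isDeterministic (M : TM2ComputableAux Γ' Γ') (Mov : Program) (E Cs c kM : ℕ) :
    (reduction M Mov E Cs c kM).IsDeterministic := withSubrun_isDeterministic _ _ _ _

/-- The program is oracle-free. [folklore] -/
theorem reduction_isOracleFree (M : TM2ComputableAux Γ' Γ') (Mov : Program) (E Cs c kM : ℕ) :
    (reduction M Mov E Cs c kM).IsOracleFree :=
  withSubrun_isOracleFree (pre_queryFree _ _ _ _ _ _) CliqueRed.post_queryFree _ _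

/-! ### Ghost parameters of a run -/

/-- The data of a run: the input formula, its width, the sparsification parameters `E` (the
exponent is `1/E`) and density `Cs`, the word-size multiplier `kM` and largest constant `cM` of the
OV program, the sparsifier `M`, its output string `out` on the input and its running time `T'`.
[folklore] -/
structure Params where
  /-- The input formula. -/
  φ : CNF ℕ
  /-- Its width. -/
  k : ℕ
  /-- Sparsification exponent `1/E`. -/
  E : ℕ
  /-- Sparsification density. -/
  Cs : ℕ
  /-- Word-size multiplier of the OV program. -/
  kM : ℕ
  /-- Largest constant of the OV program. -/
  cM : ℕ
  /-- The sparsifier. -/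
  M : TM2ComputableAux Γ' Γ'
  /-- The formulas (variable number, clauses) on its output string. -/
  Fs : List (ℕ × CNF ℕ)
  /-- Its running time on the input. -/
  T' : ℕ

namespace Params

variable (p : Params)

/-- The output string of the sparsifier. [folklore] -/
def out : List Γ' := sAll p.Fs
/-- The input words. [folklore] -/
def x : List ℕ := encodeCNFWords p.φ
/-- The input length. [folklore] -/
def L : ℕ := p.x.length
/-- The transcoded string. [folklore] -/
noncomputable def ys : List ℕ := (icodes p.M).cnfCodes p.φ
/-- Its length. [folklore] -/
noncomputable def Y : ℕ := p.ys.length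
/-- Number of variables. [folklore] -/
def n : ℕ := p.φ.numVars
/-- Split point. [folklore] -/
def hh : ℕ := (p.n + 1) / 2
/-- Half-assignments. [folklore] -/
def H : ℕ := 2 ^ p.hh
/-- Gadget width `⌈n/E⌉ + 1`. [folklore] -/
def ℓ : ℕ := (p.n + (p.E - 1)) / p.E + 1
/-- `log₂ N`. [folklore] -/
def Lg : ℕ := p.ℓ + p.hh
/-- Rows per side. [folklore] -/
def N : ℕ := 2 ^ p.Lg
/-- The dimension constant `c = 2 Cs + 3`. [folklore] -/
def c : ℕ := 2 * p.Cs + 3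
/-- Dimension. [folklore] -/
def d : ℕ := p.Lg * p.c
/-- Clause coordinates. [folklore] -/
def D : ℕ := p.n * p.Cs
/-- One side. [folklore] -/
def Nd : ℕ := p.N * p.d
/-- Length of the emulated input. [folklore] -/
def ylen : ℕ := 2 + 2 * p.Nd
/-- Bit size of the emulated input length. [folklore] -/
def szy : ℕ := Nat.size p.ylen
/-- Emulated word size. [folklore] -/
def ws : ℕ := p.szy * p.kM
/-- Emulated modulus. [folklore] -/
def Pw : ℕ := 2 ^ p.ws
/-- The region bound `V`. [folklore] -/
def V : ℕ := max (p.Pw - 1) (max p.cM p.ylen)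
/-- Base of the region: the end of the transcoded string. [folklore] -/
noncomputable def Bv : ℕ := 2 * p.L + 101 + p.Y
/-- Base of the stamps. [folklore] -/
noncomputable def Sv : ℕ := p.Bv + p.V + 1
/-- Base of the machine's data (two parameter cells below it). [folklore] -/
noncomputable def Qtm : ℕ := p.Sv + p.V + 3
/-- `H · d`. [folklore] -/
def Hd : ℕ := p.H * p.d
/-- Number of stacks. [folklore] -/
noncomputable def κ : ℕ := (TM2Emu.enc p.M.tm).κ
/-- Index of the output stack. [folklore] -/
noncomputable def i₁ : ℕ := (TM2Emu.enc p.M.tm).ι p.M.tm.k₁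
/-- Height bound of the stacks during the simulation. [folklore] -/
noncomputable def hb : ℕ := TM2Emu.heightBound p.M.tm p.Y p.T'
/-- The machine's output, in its alphabet. [folklore] -/
def out' : List (p.M.tm.Γ p.M.tm.k₁) := p.out.map p.M.outputAlphabet.symm
/-- The machine's input, in its alphabet. [folklore] -/
def inp (hw : p.φ.IsWidthLE p.k) : List (p.M.tm.Γ p.M.tm.k₀) := (KCNF.encode (toKCNF p.k p.φ hw)).map p.M.inputAlphabet.symm

/-- The data after the transcoder. [folklore] -/
noncomputable def H₁ : ℕ → ℕ := KSatTranscoder.outMem (relocated p.x) (2 * p.L + 101) p.ys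
/-- The data after the store. [folklore] -/
noncomputable def H₂ : ℕ → ℕ := Function.update (Function.update p.H₁ (p.Qtm - 2) p.n) (p.Qtm - 1) p.Bv
/-- The data after the simulation (the frozen `base` of the build). [folklore] -/
noncomputable def H₃ : ℕ → ℕ :=
  dataMem p.H₂ p.Qtm p.κ ((TM2Emu.enc p.M.tm).stk (haltList p.M.tm p.out').stk)

/-- **The build parameters** handed to the certificates of `OVFromSETHBuild.lean` /
`OVFromSETHParse.lean`. [folklore] -/
noncomputable def bp : BP :=
  ⟨p.H₃, p.n, p.hh, p.H, p.ℓ, p.N, p.d, p.D, p.Bv, p.Qtm, p.κ, p.i₁, p.out, ocd p.M⟩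

/-- The parser's code only sees the machine. [folklore] -/
theorem bp_parsePhase : p.bp.parsePhase = (codeBP p.M).parsePhase := rfl

/-- The fields and derived quantities of the build parameters, in terms of the run. [folklore] -/
theorem bpf : p.bp.Bv = p.Bv ∧ p.bp.Abase = p.Bv + 3 ∧ p.bp.Bbase = p.Bv + 3 + p.Nd ∧ p.bp.rEnd = p.Bv + 3 + p.Nd + p.Nd ∧
    p.bp.ylen = p.ylen ∧ p.bp.N = p.N ∧ p.bp.d = p.d ∧ p.bp.Nd = p.Nd ∧ p.bp.D = p.D ∧ p.bp.ℓ = p.ℓ ∧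
    p.bp.hh = p.hh ∧ p.bp.H = p.H ∧ p.bp.Hd = p.Hd ∧ p.bp.EX = p.D + 2 * p.ℓ ∧ p.bp.Qtm = p.Qtm ∧ p.bp.n = p.n ∧
    p.bp.κ = p.κ ∧ p.bp.i₁ = p.i₁ ∧ p.bp.len = p.out.length ∧ p.bp.bot = p.Qtm + p.κ + p.i₁ :=
  ⟨rfl, rfl, rfl, rfl, rfl, rfl, rfl, rfl, rfl, rfl, rfl, rfl, rfl, rfl, rfl, rfl, rfl, rfl, rfl, rfl⟩

/-- **Word-size requirements** of a run at word size `W`. [folklore] -/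
structure Fits (W : ℕ) : Prop where
  width : inputWidth p.x ≤ W
  reloc : 2 * p.L + 200 < 2 ^ W
  topTM : cellAddr p.Qtm p.κ p.κ (max p.hb p.out.length) < 2 ^ W
  gamma : (TM2Emu.enc p.M.tm).γ + 1 < 2 ^ W
  key : TM2Emu.keyBound p.M.tm < 2 ^ W
  ws_lt : p.ws < W
  n_bound : 2 * p.n + p.E + 2 < 2 ^ W

/-! ### Numeric facts -/

/-- `n ≤ 2 hh`. [folklore] -/
theorem n_le_two_hh : p.n ≤ 2 * p.hh := by unfold hh; omega

/-- `1 ≤ ℓ`, `1 ≤ Lg`, `1 ≤ N`, `H ≤ N`, `1 ≤ d`, `3 ≤ c`. [folklore] -/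
theorem small_facts : 1 ≤ p.ℓ ∧ 1 ≤ p.Lg ∧ 1 ≤ p.N ∧ p.H ≤ p.N ∧ 1 ≤ p.d ∧ 3 ≤ p.c ∧ p.H = 2 ^ p.hh ∧
    p.N = 2 ^ p.Lg ∧ p.Lg = p.ℓ + p.hh := by
  have h1 : 1 ≤ p.ℓ := Nat.le_add_left 1 _
  have h2 : 1 ≤ p.Lg := le_trans h1 (Nat.le_add_right _ _)
  have h3 : 3 ≤ p.c := by unfold c; omega
  refine ⟨h1, h2, Nat.one_le_two_pow, ?_, ?_, h3, rfl, rfl, rfl⟩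
  · exact Nat.pow_le_pow_right (by norm_num) (by unfold Lg; omega)
  · unfold d; exact le_trans h2 (Nat.le_mul_of_pos_right _ (by omega))

/-- The guard coordinate fits in a row: `D + 2ℓ < d`. [folklore] -/
theorem EX_lt_d : p.D + 2 * p.ℓ < p.d := by
  obtain ⟨hℓ, -, -, -, -, -, -, -, hLg⟩ := p.small_facts
  have hn := p.n_le_two_hh
  have h1 : p.n * p.Cs ≤ 2 * (p.hh * p.Cs) := by
    calc p.n * p.Cs ≤ (2 * p.hh) * p.Cs := Nat.mul_le_mul_right _ hn
      _ = 2 * (p.hh * p.Cs) := by ring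
  have hd : p.d = 2 * (p.ℓ * p.Cs) + 3 * p.ℓ + 2 * (p.hh * p.Cs) + 3 * p.hh := by
    unfold d c; rw [hLg]; ring
  unfold D; rw [hd]; omega

/-- The input has at least two words. [folklore] -/
theorem two_le_L : 2 ≤ p.L := by
  unfold L x; rw [KSatTranscoder.length_encodeCNFWords]; omega

/-- **The frequently used numeric facts of a run.** [folklore] -/
theorem facts {W : ℕ} (hF : p.Fits W) :
    p.Bv = 2 * p.L + 101 + p.Y ∧ p.Sv = p.Bv + p.V + 1 ∧ p.Qtm = p.Sv + p.V + 3 ∧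
    p.Pw - 1 ≤ p.V ∧ p.cM ≤ p.V ∧ p.ylen ≤ p.V ∧ p.ylen = 2 + 2 * p.Nd ∧ p.Nd = p.N * p.d ∧
    p.Hd = p.H * p.d ∧ 1 ≤ p.N ∧ p.H ≤ p.N ∧ p.N ≤ p.Nd ∧ p.d ≤ p.Nd ∧ 1 ≤ p.d ∧ p.Hd ≤ p.Nd ∧
    p.D + 2 * p.ℓ < p.d ∧ p.Qtm + p.κ < 2 ^ W ∧ 1 ≤ p.Pw ∧ 2 * p.Pw ≤ 2 ^ W ∧ 2 ≤ p.L ∧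
    2 * p.L + 200 < 2 ^ W ∧ 2 * p.n + p.E + 2 < 2 ^ W ∧ 1 < 2 ^ W := by
  obtain ⟨hℓ, hLg1, hN1, hHN, hd1, hc3, -, -, -⟩ := p.small_facts
  have hNd : p.Nd = p.N * p.d := rfl
  have hNNd : p.N ≤ p.Nd := by rw [hNd]; exact Nat.le_mul_of_pos_right _ hd1
  have hdNd : p.d ≤ p.Nd := by rw [hNd]; exact Nat.le_mul_of_pos_left _ hN1
  have hHd : p.Hd ≤ p.Nd := Nat.mul_le_mul_right _ hHN
  have hQ : p.Qtm + p.κ < 2 ^ W := by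
    have := hF.topTM; unfold cellAddr at this; omega
  have hPw1 : 1 ≤ p.Pw := Nat.one_le_two_pow
  have hPw2 : 2 * p.Pw ≤ 2 ^ W := by
    unfold Pw; rw [← Nat.pow_succ']; exact Nat.pow_le_pow_right (by norm_num) hF.ws_lt
  have h1W : 1 < 2 ^ W := by omega
  refine ⟨rfl, rfl, rfl, le_max_left _ _, le_trans (le_max_left _ _) (le_max_right _ _),
    le_trans (le_max_right _ _) (le_max_right _ _), rfl, rfl, rfl, hN1, hHN, hNNd, hdNd, hd1, hHd,
    p.EX_lt_d, hQ, hPw1, hPw2, p.two_le_L, hF.reloc, hF.n_bound, h1W⟩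

/-! ### Register conventions of the setup -/

/-- The constant registers computed by `setupOps1`: all of the build's `BRegs` but `r38 = Qtm`. [folklore] -/
structure CRegs (m : ℕ → ℕ) : Prop where
  r20 : m 20 = p.n
  r21 : m 21 = p.hh
  r22 : m 22 = p.H
  r23 : m 23 = p.ℓ
  r25 : m 25 = p.N
  r26 : m 26 = p.d
  r27 : m 27 = p.D
  r28 : m 28 = p.ylen
  r32 : m 32 = p.Bv
  r34 : m 34 = p.Bv + 3
  r35 : m 35 = p.Bv + 3 + p.Nd
  r36 : m 36 = p.Hd
  r39 : m 39 = p.D + 2 * p.ℓ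

variable {p} in
/-- The constant registers are preserved by a routine that keeps registers `20–39`. [folklore] -/
theorem CRegs.of_frame {m m' : ℕ → ℕ} (h : p.CRegs m)
    (hf : ∀ i, 20 ≤ i → i ≤ 39 → i ≠ 29 → i ≠ 30 → i ≠ 31 → i ≠ 33 → i ≠ 38 → m' i = m i) : p.CRegs m' :=
  ⟨(hf 20 (by omega) (by omega) (by omega) (by omega) (by omega) (by omega) (by omega)).trans h.r20,
    (hf 21 (by omega) (by omega) (by omega) (by omega) (by omega) (by omega) (by omega)).trans h.r21,
    (hf 22 (by omega) (by omega) (by omega) (by omega) (by omega) (by omega) (by omega)).trans h.r22,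
    (hf 23 (by omega) (by omega) (by omega) (by omega) (by omega) (by omega) (by omega)).trans h.r23,
    (hf 25 (by omega) (by omega) (by omega) (by omega) (by omega) (by omega) (by omega)).trans h.r25,
    (hf 26 (by omega) (by omega) (by omega) (by omega) (by omega) (by omega) (by omega)).trans h.r26,
    (hf 27 (by omega) (by omega) (by omega) (by omega) (by omega) (by omega) (by omega)).trans h.r27,
    (hf 28 (by omega) (by omega) (by omega) (by omega) (by omega) (by omega) (by omega)).trans h.r28,
    (hf 32 (by omega) (by omega) (by omega) (by omega) (by omega) (by omega) (by omega)).trans h.r32,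
    (hf 34 (by omega) (by omega) (by omega) (by omega) (by omega) (by omega) (by omega)).trans h.r34,
    (hf 35 (by omega) (by omega) (by omega) (by omega) (by omega) (by omega) (by omega)).trans h.r35,
    (hf 36 (by omega) (by omega) (by omega) (by omega) (by omega) (by omega) (by omega)).trans h.r36,
    (hf 39 (by omega) (by omega) (by omega) (by omega) (by omega) (by omega) (by omega)).trans h.r39⟩

variable {p} in
/-- With `r38 = Qtm`, the constant registers are the build's. [folklore] -/
theorem CRegs.bRegs {m : ℕ → ℕ} (h : p.CRegs m) (h38 : m 38 = p.Qtm) : p.bp.BRegs m :=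
  ⟨h.r20, h.r21, h.r22, h.r23, h.r25, h.r26, h.r27, h.r28, h.r32, h.r34, h.r35, h.r36, h38, h.r39⟩

variable {p} in
/-- The build's registers contain the constant registers. [folklore] -/
theorem cRegs_of_bRegs {m : ℕ → ℕ} (h : p.bp.BRegs m) : p.CRegs m :=
  ⟨h.r20, h.r21, h.r22, h.r23, h.r25, h.r26, h.r27, h.r28, h.r32, h.r34, h.r35, h.r36, h.r39⟩

/-- The registers after the setup: the registers of the build and `ws` (`29`), `Pw` (`30`), `V` (`31`),
`Sv` (`33`). [folklore] -/
def SRegs (m : ℕ → ℕ) : Prop :=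
  p.bp.BRegs m ∧ m 29 = p.ws ∧ m 30 = p.Pw ∧ m 31 = p.V ∧ m 33 = p.Sv

variable {W : ℕ} {O : List ℕ → List ℕ}

/-- **Setup, part 1.** From `n` (register `20`) and `Bv` (register `32`), `setupOps1` computes the
constant registers, `r50 := |y|` and `r29 := 0`. [folklore] -/
theorem setup1_spec (hF : p.Fits W) {m : ℕ → ℕ} (h20 : m 20 = p.n) (h32 : m 32 = p.Bv) :
    Achieves W O (block (setupOps1 p.E p.Cs p.c)) m (fun m' => p.CRegs m' ∧ m' 24 = p.Lg ∧ m' 37 = p.Nd ∧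
      m' 50 = p.ylen ∧ m' 29 = 0 ∧ (∀ i, i < 20 → m' i = m i) ∧ ∀ a, 100 ≤ a → m' a = m a) 20 := by
  obtain ⟨hBv, hSv, hQ, hV1, hV2, hV3, hy, hNd, hHd, hN1, hHN, hNNd, hdNd, hd1, hHdNd, hEX, hQW, hPw1, hPw2,
    hL2, hLW, hnW, h1W⟩ := p.facts hF
  obtain ⟨hℓ, hLg1, -, -, -, hc3, hH, hN, hLg⟩ := p.small_facts
  have hhh : (p.n + 1) / 2 = p.hh := rfl
  have hℓd : (p.n + (p.E - 1)) / p.E + 1 = p.ℓ := rfl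
  have hdd : p.Lg * p.c = p.d := rfl
  have hDD : p.n * p.Cs = p.D := rfl
  have hH' : 1 * 2 ^ p.hh = p.H := by rw [Nat.one_mul]; rfl
  have hN' : 1 * 2 ^ p.Lg = p.N := by rw [Nat.one_mul]; rfl
  have hHd' : p.H * p.d = p.Hd := rfl
  have hNd' : p.N * p.d = p.Nd := rfl
  have hhn : p.hh ≤ p.n := by unfold hh; omega
  have hℓ2 : p.ℓ * 2 < p.d := by omega
  have hLg' : p.ℓ + p.hh = p.Lg := rfl
  refine achieves_block_of_eq (fun m' hm' => ?_) le_rfl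
  unfold setupOps1 at hm'
  simp (disch := omega) only [execOps_cons, execOps_nil, execOp, Operand.write,
    Operand.read, merge_apply_of_lt, update_merge_of_lt, Function.update_self,
    Function.update_of_ne, BinOp.eval_add_of_lt, BinOp.eval_div, BinOp.eval_band, Nat.and_self, Nat.add_zero,
    h20, h32, hhh, hℓd, hLg', BinOp.eval_shl_of_lt (show 1 * 2 ^ p.hh < 2 ^ W by omega), hH',
    BinOp.eval_shl_of_lt (show 1 * 2 ^ p.Lg < 2 ^ W by omega), hN',
    BinOp.eval_mul_of_lt (show p.Lg * p.c < 2 ^ W by omega), hdd,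
    BinOp.eval_mul_of_lt (show p.n * p.Cs < 2 ^ W by omega), hDD,
    BinOp.eval_mul_of_lt (show p.H * p.d < 2 ^ W by omega), hHd',
    BinOp.eval_mul_of_lt (show p.N * p.d < 2 ^ W by omega), hNd',
    BinOp.eval_mul_of_lt (show p.Nd * 2 < 2 ^ W by omega),
    BinOp.eval_mul_of_lt (show p.ℓ * 2 < 2 ^ W by omega)] at hm'
  subst hm'
  refine ⟨⟨?_, ?_, ?_, ?_, ?_, ?_, ?_, ?_, ?_, ?_, ?_, ?_, ?_⟩, ?_, ?_, ?_, ?_, fun i hi => ?_, fun a ha => ?_⟩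
  all_goals (try simp (disch := omega) only [merge_apply_of_lt, merge_apply_of_le, Function.update_self,
    Function.update_of_ne])
  all_goals omega

/-- **Setup, part 2: the size loop** (as `CliqueRed.sizeLoop_spec`, registers `50`, `29`). [folklore] -/
theorem sizeLoop_spec {m : ℕ → ℕ} {v : ℕ} (h50 : m 50 = v) (h29 : m 29 = 0) (hv : v < 2 ^ W) :
    Achieves W O sizeLoop m
      (fun m' => m' 29 = Nat.size v ∧ m' 50 = 0 ∧ ∀ a, a ≠ 50 → a ≠ 29 → m' a = m a)
      (Nat.size v * 4 + 1) := by
  have hsz : Nat.size v ≤ W := Nat.size_le.2 hv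
  have hW : W < 2 ^ W := Nat.lt_two_pow_self
  refine Achieves.whilenz (Nat.size v) 2
    (fun i m' => m' 50 = v / 2 ^ i ∧ m' 29 = i ∧ ∀ a, a ≠ 50 → a ≠ 29 → m' a = m a)
    (fun i hi m' ⟨h1, h2, h3⟩ => ⟨?_, ?_⟩) (fun m' ⟨h1, _, _⟩ => ?_) ⟨by simpa using h50, h29,
    fun a _ _ => rfl⟩ (fun m' ⟨h1, h2, h3⟩ => ⟨h2, ?_, h3⟩) le_rfl
  · have : 2 ^ i ≤ v := Nat.lt_size.1 hi
    simp only [Operand.read, h1]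
    exact (Nat.div_pos this (Nat.two_pow_pos i)).ne'
  · refine achieves_block_of_eq (fun m'' hm'' => ?_) le_rfl
    simp (disch := omega) only [execOps_cons, execOps_nil, execOp, Operand.write,
      Operand.read, merge_apply_of_lt, update_merge_of_lt, Function.update_of_ne,
      BinOp.eval_add_of_lt, BinOp.eval_shr, h1, h2] at hm''
    subst hm''
    refine ⟨?_, ?_, fun a ha1 ha2 => ?_⟩
    · simp (disch := omega) only [merge_apply_of_lt, Function.update_self, Function.update_of_ne]
      rw [Nat.shiftRight_eq_div_pow, Nat.div_div_eq_div_mul, ← pow_succ]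
    · simp (disch := omega) only [merge_apply_of_lt, Function.update_self]
    · by_cases ha : a < 100
      · rw [merge_apply_of_lt ha, Function.update_of_ne ha2, Function.update_of_ne ha1, h3 a ha1 ha2]
      · rw [merge_apply_of_le (by omega), h3 a ha1 ha2]
  · simp only [Operand.read, h1]
    exact Nat.div_eq_of_lt (Nat.lt_size_self v)
  · rw [h1]; exact Nat.div_eq_of_lt (Nat.lt_size_self v)

set_option linter.unusedSimpArgs false in
/-- **Setup, part 3.** From `|y|` (register `28`), `size |y|` (register `29`) and `Bv` (register `32`):
`ws`, `Pw`, `V`, `Sv`, `Qtm` into registers `29, 30, 31, 33, 38`. [folklore] -/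
theorem setup3_spec (hF : p.Fits W) {m : ℕ → ℕ} (h28 : m 28 = p.ylen) (h29 : m 29 = p.szy) (h32 : m 32 = p.Bv) :
    Achieves W O (setup3 p.kM p.cM) m (fun m' => (m' 29 = p.ws ∧ m' 30 = p.Pw ∧ m' 31 = p.V ∧ m' 33 = p.Sv ∧
      m' 38 = p.Qtm) ∧ ∀ a, a ≠ 29 → a ≠ 30 → a ≠ 31 → a ≠ 33 → a ≠ 38 → a ≠ 52 → m' a = m a) (4 + ((1 + 2) + (1 + ((1 + 2) + (4 + 0))))) := by
  obtain ⟨hBv, hSv, hQ, hV1, hV2, hV3, hy, hNd, hHd, hN1, hHN, hNNd, hdNd, hd1, hHdNd, hEX, hQW, hPw1, hPw2,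
    hL2, hLW, hnW, h1W⟩ := p.facts hF
  have hws : p.szy * p.kM = p.ws := rfl
  have hPw : 1 * 2 ^ p.ws = p.Pw := Nat.one_mul _
  have hPwW : 1 * 2 ^ p.ws < 2 ^ W := by rw [hPw]; omega
  have hwsW : p.szy * p.kM < 2 ^ W := lt_trans hF.ws_lt Nat.lt_two_pow_self
  have r28 := h28
  unfold setup3
  -- block 1
  refine Achieves.seqs_cons (R := fun m₁ => m₁ 29 = p.ws ∧ m₁ 30 = p.Pw ∧ m₁ 31 = p.Pw - 1 ∧
      m₁ 52 = (if p.Pw - 1 < p.cM then 1 else 0) ∧ ∀ a, a ≠ 29 → a ≠ 30 → a ≠ 31 → a ≠ 52 → m₁ a = m a)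
    (T₁ := 4) ?_ ?_
  · refine achieves_block_of_eq (fun m' hm' => ?_) le_rfl
    simp (disch := omega) only [execOps_cons, execOps_nil, execOp, Operand.write,
      Operand.read, merge_apply_of_lt, update_merge_of_lt, Function.update_self, Function.update_of_ne,
      BinOp.eval_mul_of_lt hwsW, hws,
      BinOp.eval_shl_of_lt hPwW, hPw, BinOp.eval_sub_of_le hPw1 (show p.Pw < 2 ^ W by omega), BinOp.eval_lt,
      h29] at hm'
    subst hm'
    refine ⟨?_, ?_, ?_, ?_, fun a h1 h2 h3 h4 => ?_⟩
    · simp (disch := omega) only [merge_apply_of_lt, Function.update_self, Function.update_of_ne]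
    · simp (disch := omega) only [merge_apply_of_lt, Function.update_self, Function.update_of_ne]
    · simp (disch := omega) only [merge_apply_of_lt, Function.update_self, Function.update_of_ne]
    · simp (disch := omega) only [merge_apply_of_lt, Function.update_self, Function.update_of_ne]
    · by_cases ha : a < 100
      · rw [merge_apply_of_lt ha]; simp (disch := omega) only [Function.update_of_ne]
      · rw [merge_apply_of_le (by omega)]
  rintro m₁ ⟨q29, q30, q31, q52, qf⟩
  -- first maximum
  refine Achieves.seqs_cons (R := fun m₂ => m₂ 29 = p.ws ∧ m₂ 30 = p.Pw ∧ m₂ 31 = max (p.Pw - 1) p.cM ∧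
      ∀ a, a ≠ 29 → a ≠ 30 → a ≠ 31 → a ≠ 52 → m₂ a = m a) (T₁ := 1 + 2) ?_ ?_
  · refine Achieves.ifz (fun h0 => Achieves.skip ⟨q29, q30, ?_, qf⟩) (fun h1 => ?_)
    · simp only [Operand.read, q52] at h0
      have : ¬ p.Pw - 1 < p.cM := fun h => by rw [if_pos h] at h0; exact one_ne_zero h0
      rw [q31, max_eq_left (Nat.not_lt.1 this)]
    · simp only [Operand.read, q52] at h1
      have hlt : p.Pw - 1 < p.cM := by by_contra h; rw [if_neg h] at h1; exact h1 rfl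
      refine achieves_block_of_eq (fun m' hm' => ?_) le_rfl
      simp (disch := omega) only [execOps_cons, execOps_nil, execOp, Operand.write,
        Operand.read, update_merge_of_lt, BinOp.eval_band, Nat.and_self] at hm'
      subst hm'
      refine ⟨?_, ?_, ?_, fun a h1 h2 h3 h4 => ?_⟩
      · simp (disch := omega) only [merge_apply_of_lt, Function.update_of_ne, q29]
      · simp (disch := omega) only [merge_apply_of_lt, Function.update_of_ne, q30]
      · simp (disch := omega) only [merge_apply_of_lt, Function.update_self]
        rw [max_eq_right hlt.le]
      · by_cases ha : a < 100
        · rw [merge_apply_of_lt ha, Function.update_of_ne h3, qf a h1 h2 h3 h4]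
        · rw [merge_apply_of_le (by omega), qf a h1 h2 h3 h4]
  rintro m₂ ⟨s29, s30, s31, sf⟩
  have s28 : m₂ 28 = p.ylen := by rw [sf 28 (by omega) (by omega) (by omega) (by omega), r28]
  have hm1 : max (p.Pw - 1) p.cM ≤ p.V := max_le hV1 hV2
  -- second comparison
  refine Achieves.seqs_cons (R := fun m₃ => m₃ 52 = (if max (p.Pw - 1) p.cM < p.ylen then 1 else 0) ∧
      m₃ 29 = p.ws ∧ m₃ 30 = p.Pw ∧ m₃ 31 = max (p.Pw - 1) p.cM ∧
      ∀ a, a ≠ 29 → a ≠ 30 → a ≠ 31 → a ≠ 52 → m₃ a = m a) (T₁ := 1) ?_ ?_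
  · refine achieves_block_of_eq (fun m' hm' => ?_) le_rfl
    simp (disch := omega) only [execOps_cons, execOps_nil, execOp, Operand.write,
      Operand.read, merge_apply_of_lt, update_merge_of_lt, BinOp.eval_lt, s31, s28] at hm'
    subst hm'
    refine ⟨?_, ?_, ?_, ?_, fun a h1 h2 h3 h4 => ?_⟩
    · simp (disch := omega) only [merge_apply_of_lt, Function.update_self]
    · simp (disch := omega) only [merge_apply_of_lt, Function.update_of_ne, s29]
    · simp (disch := omega) only [merge_apply_of_lt, Function.update_of_ne, s30]
    · simp (disch := omega) only [merge_apply_of_lt, Function.update_of_ne, s31]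
    · by_cases ha : a < 100
      · rw [merge_apply_of_lt ha, Function.update_of_ne h4, sf a h1 h2 h3 h4]
      · rw [merge_apply_of_le (by omega), sf a h1 h2 h3 h4]
  rintro m₃ ⟨t52, t29, t30, t31, tf⟩
  -- second maximum
  refine Achieves.seqs_cons (R := fun m₄ => m₄ 29 = p.ws ∧ m₄ 30 = p.Pw ∧ m₄ 31 = p.V ∧
      ∀ a, a ≠ 29 → a ≠ 30 → a ≠ 31 → a ≠ 52 → m₄ a = m a) (T₁ := 1 + 2) ?_ ?_
  · have hVe : p.V = max (max (p.Pw - 1) p.cM) p.ylen := by unfold V; rw [max_assoc]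
    refine Achieves.ifz (fun h0 => Achieves.skip ⟨t29, t30, ?_, tf⟩) (fun h1 => ?_)
    · simp only [Operand.read, t52] at h0
      have : ¬ max (p.Pw - 1) p.cM < p.ylen := fun h => by rw [if_pos h] at h0; exact one_ne_zero h0
      rw [t31, hVe, max_eq_left (Nat.not_lt.1 this)]
    · simp only [Operand.read, t52] at h1
      have hlt : max (p.Pw - 1) p.cM < p.ylen := by by_contra h; rw [if_neg h] at h1; exact h1 rfl
      have t28 : m₃ 28 = p.ylen := by rw [tf 28 (by omega) (by omega) (by omega) (by omega), r28]
      refine achieves_block_of_eq (fun m' hm' => ?_) le_rfl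
      simp (disch := omega) only [execOps_cons, execOps_nil, execOp, Operand.write,
        Operand.read, merge_apply_of_lt, update_merge_of_lt, BinOp.eval_band, Nat.and_self, t28] at hm'
      subst hm'
      refine ⟨?_, ?_, ?_, fun a h1 h2 h3 h4 => ?_⟩
      · simp (disch := omega) only [merge_apply_of_lt, Function.update_of_ne, t29]
      · simp (disch := omega) only [merge_apply_of_lt, Function.update_of_ne, t30]
      · simp (disch := omega) only [merge_apply_of_lt, Function.update_self]
        rw [hVe, max_eq_right hlt.le]
      · by_cases ha : a < 100
        · rw [merge_apply_of_lt ha, Function.update_of_ne h3, tf a h1 h2 h3 h4]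
        · rw [merge_apply_of_le (by omega), tf a h1 h2 h3 h4]
  rintro m₄ ⟨u29, u30, u31, uf⟩
  -- the bases
  have u32 : m₄ 32 = p.Bv := by rw [uf 32 (by omega) (by omega) (by omega) (by omega)]; exact h32
  refine Achieves.seqs_cons (T₁ := 4) (T₂ := 0) ?_ fun _ h => Achieves.seqs_nil h
  refine achieves_block_of_eq (fun m' hm' => ?_) le_rfl
  simp (disch := omega) only [execOps_cons, execOps_nil, execOp, Operand.write,
    Operand.read, merge_apply_of_lt, update_merge_of_lt, Function.update_self, Function.update_of_ne,
    BinOp.eval_add_of_lt, u31, u32] at hm'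
  subst hm'
  have hfr : ∀ a, a ≠ 29 → a ≠ 30 → a ≠ 31 → a ≠ 33 → a ≠ 38 → a ≠ 52 →
      merge (Function.update (Function.update (Function.update (Function.update m₄ 33 (p.Bv + p.V)) 33
        (p.Bv + p.V + 1)) 38 (p.Bv + p.V + 1 + p.V)) 38 (p.Bv + p.V + 1 + p.V + 3)) m₄ a = m a := by
    intro a h1 h2 h3 h4 h5 h6
    by_cases ha : a < 100
    · rw [merge_apply_of_lt ha]; simp (disch := omega) only [Function.update_of_ne]; exact uf a h1 h2 h3 h6
    · rw [merge_apply_of_le (by omega)]; exact uf a h1 h2 h3 h6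
  refine ⟨⟨?_, ?_, ?_, ?_, ?_⟩, fun a h1 h2 h3 h4 h5 h6 => hfr a h1 h2 h3 h4 h5 h6⟩
  · simp (disch := omega) only [merge_apply_of_lt, Function.update_of_ne, u29]
  · simp (disch := omega) only [merge_apply_of_lt, Function.update_of_ne, u30]
  · simp (disch := omega) only [merge_apply_of_lt, Function.update_of_ne, u31]
  · simp (disch := omega) only [merge_apply_of_lt, Function.update_self, Function.update_of_ne]; omega
  · simp (disch := omega) only [merge_apply_of_lt, Function.update_self, Function.update_of_ne]; omega

/-- The time of the setup. [folklore] -/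
def Tsetup : ℕ := 20 + ((p.szy * 4 + 1) + ((4 + ((1 + 2) + (1 + ((1 + 2) + (4 + 0))))) + 0))

/-- **The setup.** [folklore] -/
theorem setupP_spec (hF : p.Fits W) {m : ℕ → ℕ} (h20 : m 20 = p.n) (h32 : m 32 = p.Bv) :
    Achieves W O (setupP p.E p.Cs p.c p.kM p.cM) m (fun m' => p.SRegs m' ∧ (∀ i, i < 20 → m' i = m i) ∧
      ∀ a, 100 ≤ a → m' a = m a) p.Tsetup := by
  obtain ⟨hBv, hSv, hQ, hV1, hV2, hV3, hy, hNd, hHd, hN1, hHN, hNNd, hdNd, hd1, hHdNd, hEX, hQW, hPw1, hPw2,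
    hL2, hLW, hnW, h1W⟩ := p.facts hF
  have hyW : p.ylen < 2 ^ W := by omega
  unfold setupP Tsetup
  refine Achieves.seqs_cons (p.setup1_spec hF h20 h32) ?_
  rintro m₁ ⟨hC₁, -, -, h50, h29, hlow₁, hD₁⟩
  refine Achieves.seqs_cons ((sizeLoop_spec (O := O) h50 h29 hyW).mono (fun _ h => h) le_rfl) ?_
  rintro m₂ ⟨s29, -, sf⟩
  refine Achieves.seqs_cons (T₂ := 0) (p.setup3_spec hF ((sf 28 (by omega) (by omega)).trans hC₁.r28) s29
    ((sf 32 (by omega) (by omega)).trans hC₁.r32)) ?_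
  rintro m₃ ⟨⟨u29, u30, u31, u33, u38⟩, uf⟩
  have hC₂ : p.CRegs m₂ := hC₁.of_frame fun i (h1 : 20 ≤ i) (h2 : i ≤ 39) (h3 : i ≠ 29) _ _ _ _ =>
    sf i (by omega) h3
  have hC₃ : p.CRegs m₃ := hC₂.of_frame fun i (h1 : 20 ≤ i) (h2 : i ≤ 39) h29 h30 h31 h33 h38 =>
    uf i h29 h30 h31 h33 h38 (by omega)
  refine Achieves.seqs_nil ⟨⟨hC₃.bRegs u38, u29, u30, u31, u33⟩, fun i hi => ?_, fun a ha => ?_⟩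
  · rw [uf i (by omega) (by omega) (by omega) (by omega) (by omega) (by omega), sf i (by omega) (by omega), hlow₁ i hi]
  · rw [uf a (by omega) (by omega) (by omega) (by omega) (by omega) (by omega), sf a (by omega) (by omega), hD₁ a ha]

/-! ### The environment phase -/

set_option linter.unusedSimpArgs false in
/-- **The environment phase.** From the build's registers, `envPhase` loads `Bv, Sv, 0, Pw` into the
layout registers `10–13`, keeping the data. [folklore] -/
theorem envPhase_spec (hF : p.Fits W) {m : ℕ → ℕ} (hB : p.bp.BRegs m) :
    Achieves W O (envPhase p.kM p.cM) m (fun m' => m' 10 = p.Bv ∧ m' 11 = p.Sv ∧ m' 12 = 0 ∧ m' 13 = p.Pw ∧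
      ∀ a, 100 ≤ a → m' a = m a) (2 + ((p.szy * 4 + 1) + ((4 + ((1 + 2) + (1 + ((1 + 2) + (4 + 0))))) + (4 + 0)))) := by
  obtain ⟨hBv, hSv, hQ, hV1, hV2, hV3, hy, hNd, hHd, hN1, hHN, hNNd, hdNd, hd1, hHdNd, hEX, hQW, hPw1, hPw2,
    hL2, hLW, hnW, h1W⟩ := p.facts hF
  have hyW : p.ylen < 2 ^ W := by omega
  have hC : p.CRegs m := cRegs_of_bRegs hB
  have r28 : m 28 = p.ylen := hC.r28
  unfold envPhase
  refine Achieves.seqs_cons (R := fun m₁ => p.CRegs m₁ ∧ m₁ 50 = p.ylen ∧ m₁ 29 = 0 ∧ ∀ a, 100 ≤ a → m₁ a = m a)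
    (T₁ := 2) ?_ ?_
  · refine achieves_block_of_eq (fun m' hm' => ?_) le_rfl
    simp (disch := omega) only [execOps_cons, execOps_nil, execOp, Operand.write,
      Operand.read, merge_apply_of_lt, update_merge_of_lt, Function.update_self, Function.update_of_ne,
      BinOp.eval_add_of_lt, BinOp.eval_band, Nat.and_self, Nat.add_zero, r28] at hm'
    subst hm'
    refine ⟨hC.of_frame ?_, ?_, ?_, fun a ha => ?_⟩
    · intro i h1 h2 h3 _ _ _ _
      rw [merge_apply_of_lt (by omega)]; simp (disch := omega) only [Function.update_of_ne]
    · simp (disch := omega) only [merge_apply_of_lt, Function.update_self, Function.update_of_ne]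
    · simp (disch := omega) only [merge_apply_of_lt, Function.update_self, Function.update_of_ne]
    · rw [merge_apply_of_le ha]
  rintro m₁ ⟨hC₁, h50, h29, hD₁⟩
  refine Achieves.seqs_cons ((sizeLoop_spec (O := O) h50 h29 hyW).mono (fun _ h => h) le_rfl) ?_
  rintro m₂ ⟨s29, -, sf⟩
  refine Achieves.seqs_cons (p.setup3_spec hF ((sf 28 (by omega) (by omega)).trans hC₁.r28) s29
    ((sf 32 (by omega) (by omega)).trans hC₁.r32)) ?_
  rintro m₃ ⟨⟨u29, u30, u31, u33, u38⟩, uf⟩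
  have u32 : m₃ 32 = p.Bv := by
    rw [uf 32 (by omega) (by omega) (by omega) (by omega) (by omega) (by omega), sf 32 (by omega) (by omega)]; exact hC₁.r32
  refine Achieves.seqs_cons (T₂ := 0) ?_ fun _ h => Achieves.seqs_nil h
  refine achieves_block_of_eq (fun m' hm' => ?_) le_rfl
  unfold envOps at hm'
  simp (disch := omega) only [execOps_cons, execOps_nil, execOp, Operand.write,
    Operand.read, merge_apply_of_lt, update_merge_of_lt, Function.update_self, Function.update_of_ne,
    BinOp.eval_add_of_lt, BinOp.eval_band, Nat.and_self, Nat.add_zero, u32, u33, u30] at hm'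
  subst hm'
  refine ⟨?_, ?_, ?_, ?_, fun a ha => ?_⟩
  · simp (disch := omega) only [merge_apply_of_lt, Function.update_self, Function.update_of_ne]
  · simp (disch := omega) only [merge_apply_of_lt, Function.update_self, Function.update_of_ne]
  · simp (disch := omega) only [merge_apply_of_lt, Function.update_self, Function.update_of_ne]
  · simp (disch := omega) only [merge_apply_of_lt, Function.update_self, Function.update_of_ne]
  · rw [merge_apply_of_le ha, uf a (by omega) (by omega) (by omega) (by omega) (by omega) (by omega),
      sf a (by omega) (by omega), hD₁ a ha]


/-! ### The data through the build -/

/-- The transcoder produces exactly the codes of the machine's input (as `SETHBridge.cnfCodes_eq_map_inp`). [folklore] -/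
theorem ys_eq_map_inp (hw : p.φ.IsWidthLE p.k) : p.ys = (p.inp hw).map ((TM2Emu.enc p.M.tm).code p.M.tm.k₀) := by
  have hbit : ∀ b, (icodes p.M).bit b = icd p.M (.bit b) := fun b => by cases b <;> rfl
  have hbits : ∀ v, (icodes p.M).bitsCode v = ((encodeNat v).map Γ'.bit).map (icd p.M) := fun v => by
    simp [KSatTranscoder.Codes.bitsCode, encodeNat_eq_natBits, hbit]
  have hlit : ∀ l : ℕ × Bool, (icodes p.M).litCodes l = (KCNF.encodeLiteral l).map (icd p.M) := fun l => by
    simp [KSatTranscoder.Codes.litCodes, KCNF.encodeLiteral, hbits, hbit]; rfl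
  have hcl : ∀ c : List (ℕ × Bool), (icodes p.M).clauseCodes c = (KCNF.encodeClause c).map (icd p.M) :=
    fun c => by
    simp only [KSatTranscoder.Codes.clauseCodes, KCNF.encodeClause, List.map_cons, List.map_append, List.map_flatMap,
      List.map_nil]
    rw [show (icodes p.M).bra = icd p.M .bra from rfl, show (icodes p.M).ket = icd p.M .ket from rfl]
    congr 2
    exact List.flatMap_congr fun l _ => hlit l
  unfold ys
  simp only [inp, List.map_map, KSatTranscoder.Codes.cnfCodes, KCNF.encode, toKCNF, List.map_append, List.map_cons,
    List.map_flatMap, hbits]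
  rw [show (icodes p.M).comma = icd p.M .comma from rfl]
  congr 2
  · exact List.flatMap_congr fun c _ => (hcl c).trans (by rfl)

/-- The length of the transcoded string is that of the machine's input. [folklore] -/
theorem Y_eq (hw : p.φ.IsWidthLE p.k) : p.Y = (p.inp hw).length := by
  unfold Y; rw [p.ys_eq_map_inp hw, List.length_map]

/-- `H₁` below the string base is the relocated input; in particular `n` sits at `L + 101`. [folklore] -/
theorem H₁_n : p.H₁ (p.L + 101) = p.n := by
  have hL := p.two_le_L
  unfold H₁
  rw [KSatTranscoder.outMem_of_lt _ _ (by omega)]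
  have := relocated_base_add p.x (i := 1) le_rfl (by unfold L at hL; omega)
  rw [show p.x.length + 100 + 1 = p.L + 101 by unfold L; omega] at this
  rw [this]
  unfold n x
  rw [List.getD_eq_getElem?_getD, KSatTranscoder.encodeCNFWords_eq]; rfl

/-- `H₁` is `0` from the end of the string on. [folklore] -/
theorem H₁_of_Bv_le {a : ℕ} (ha : p.Bv ≤ a) : p.H₁ a = 0 := by
  unfold H₁
  rw [KSatTranscoder.outMem_of_le _ _ (by unfold Bv Y at ha; exact ha)]
  exact relocated_of_lt _ (by unfold Bv L at ha; omega)

/-- `H₁` holds the string. [folklore] -/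
theorem H₁_string {t : ℕ} (ht : t < p.Y) : p.H₁ (2 * p.L + 101 + t) = p.ys[t]'ht := by
  unfold H₁; exact KSatTranscoder.outMem_add _ _ _ ht

/-- Every code of the transcoded string is one of the five codes. [folklore] -/
theorem mem_cnfCodes_le_sup (C : KSatTranscoder.Codes) (φ : CNF ℕ) : ∀ c ∈ C.cnfCodes φ, c ≤ C.sup := by
  have hbits : ∀ v, ∀ c ∈ C.bitsCode v, c ≤ C.sup := fun v c hc => by
    simp only [KSatTranscoder.Codes.bitsCode, List.mem_map] at hc
    obtain ⟨b, -, rfl⟩ := hc; exact C.bit_le_sup _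
  have hlit : ∀ l, ∀ c ∈ C.litCodes l, c ≤ C.sup := fun l c hc => by
    unfold KSatTranscoder.Codes.litCodes at hc
    rw [List.cons_append, List.mem_cons, List.mem_append, List.mem_singleton] at hc
    rcases hc with rfl | hc | rfl
    · exact C.bit_le_sup _
    · exact hbits _ _ hc
    · exact C.comma_le_sup
  have hcl : ∀ cl, ∀ c ∈ C.clauseCodes cl, c ≤ C.sup := fun cl c hc => by
    unfold KSatTranscoder.Codes.clauseCodes at hc
    rw [List.cons_append, List.mem_cons, List.mem_append, List.mem_singleton, List.mem_flatMap] at hc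
    rcases hc with rfl | ⟨l, -, hc⟩ | rfl
    · exact C.bra_le_sup
    · exact hlit _ _ hc
    · exact C.ket_le_sup
  intro c hc
  simp only [KSatTranscoder.Codes.cnfCodes, List.mem_append, List.mem_cons, List.mem_flatMap] at hc
  rcases hc with hc | rfl | ⟨cl, -, hc⟩
  · exact hbits _ _ hc
  · exact C.comma_le_sup
  · exact hcl _ _ hc

/-- Every cell of `H₁` is an input word, a code or `0`. [folklore] -/
theorem H₁_lt (hF : p.Fits W) (a : ℕ) : p.H₁ a < 2 ^ W := by
  have hγ := hF.gamma
  have hcodes : ∀ c ∈ p.ys, c < 2 ^ W := by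
    intro c hc
    have hsup : (icodes p.M).sup ≤ (TM2Emu.enc p.M.tm).γ := by
      have h : ∀ γ, icd p.M γ ≤ (TM2Emu.enc p.M.tm).γ := fun γ =>
        (TM2Emu.enc_good p.M.tm).code_le _ _ (TM2Emu.mem_alphabet_k₀ p.M.tm _)
      simp only [icodes, KSatTranscoder.Codes.sup]
      have := h (.bit false); have := h (.bit true); have := h .bra; have := h .ket; have := h .comma
      omega
    have := mem_cnfCodes_le_sup (icodes p.M) p.φ c hc
    omega
  unfold H₁ KSatTranscoder.outMem
  split_ifs with h
  · rw [List.getD_eq_getElem _ _ (by omega)]; exact hcodes _ (List.getElem_mem _)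
  · have hx : ∀ v ∈ p.x, v < 2 ^ W := fun v hv =>
      lt_of_lt_of_le (lt_two_pow_inputWidth_of_mem _ v hv) (Nat.pow_le_pow_right Nat.two_pos hF.width)
    unfold relocated
    have hg : ∀ i, p.x.getD i 0 < 2 ^ W := fun i => by
      rw [List.getD_eq_getElem?_getD]
      cases hq : p.x[i]? with
      | none => simp
      | some v => simpa using hx v (List.mem_of_getElem? hq)
    have := (p.facts hF).2.2.2.2.2.2.2.2.2.2.2.2.2.2.2.2.2.2.2.2.1
    unfold L at this
    split_ifs <;> first | exact hg _ | omega

/-- `H₂`: the two parameter cells, `H₁` elsewhere. [folklore] -/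
theorem H₂_apply (hF : p.Fits W) (a : ℕ) :
    p.H₂ a = if a = p.Qtm - 1 then p.Bv else if a = p.Qtm - 2 then p.n else p.H₁ a := by
  obtain ⟨hBv, hSv, hQ, -⟩ := p.facts hF
  unfold H₂
  by_cases h1 : a = p.Qtm - 1
  · rw [if_pos h1, h1, Function.update_self]
  rw [if_neg h1, Function.update_of_ne h1]
  by_cases h2 : a = p.Qtm - 2
  · rw [if_pos h2, h2, Function.update_self]
  · rw [if_neg h2, Function.update_of_ne h2]

/-- The code lists of the halting configuration: the output codes on the output stack. [folklore] -/
theorem stk_halt : (TM2Emu.enc p.M.tm).stk (haltList p.M.tm p.out').stk =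
    Function.update (fun _ => ([] : List ℕ)) p.i₁
      (p.out.map fun γ => (TM2Emu.enc p.M.tm).code p.M.tm.k₁ (p.M.outputAlphabet.symm γ)) := by
  rw [TM2Emu.stk_haltList]; unfold i₁ out'; rw [List.map_map]; rfl

/-- The address of symbol `s` is the cell of height `len - s` of the output stack. [folklore] -/
theorem bp_addr (s : ℕ) : p.bp.addr s = cellAddr p.Qtm p.κ p.i₁ (p.out.length - s) := by
  show p.Qtm + p.κ + p.i₁ + p.κ * (p.out.length - s) = p.Qtm + p.κ + p.κ * (p.out.length - s) + p.i₁
  omega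

/-- **`H₃` reads the tape**: at the address of symbol `s` sits its code (and `0` at the bottom), provided
the output symbols lie in the working alphabet. [folklore] -/
theorem H₃_tape (halph : ∀ a ∈ p.out', a ∈ TM2Emu.alphabet p.M.tm p.M.tm.k₁) (s : ℕ) (hs : s ≤ p.out.length) :
    p.H₃ (p.bp.addr s) = p.bp.tape s := by
  have hi : p.i₁ < p.κ := (TM2Emu.enc_good p.M.tm).ι_lt _
  unfold H₃
  rw [p.bp_addr, p.stk_halt, dataMem_cellAddr _ _ _ hi, Function.update_self]
  unfold BP.tape
  simp only [show p.bp.len = p.out.length from rfl, show p.bp.str = p.out from rfl, show p.bp.cd = ocd p.M from rfl]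
  by_cases hlt : s < p.out.length
  · rw [dif_pos hlt]
    have hmem : p.M.outputAlphabet.symm (p.out[s]) ∈ TM2Emu.alphabet p.M.tm p.M.tm.k₁ :=
      halph _ (by unfold out'; exact List.mem_map.2 ⟨_, List.getElem_mem _, rfl⟩)
    unfold stackCell
    rw [if_neg (by omega), List.getD_eq_getElem _ _ (by simp; omega)]
    simp only [List.getElem_reverse, List.length_map, List.getElem_map]
    rw [ocd_of_mem _ hmem]
    congr 2
    congr 1; omega
  · rw [dif_neg hlt, show p.out.length - s = 0 by omega, stackCell_zero]

/-- The pointer-table entry of the output stack is the address of symbol `0`. [folklore] -/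
theorem H₃_ptr : p.H₃ (p.Qtm + p.i₁) = p.bp.addr 0 := by
  have hi : p.i₁ < p.κ := (TM2Emu.enc_good p.M.tm).ι_lt _
  unfold H₃
  rw [p.stk_halt, dataMem_ptr _ _ _ hi, Function.update_self, List.length_map, p.bp_addr, Nat.sub_zero]

/-- Below the machine's base, `H₃` is `H₂`. [folklore] -/
theorem H₃_of_lt {a : ℕ} (ha : a < p.Qtm) : p.H₃ a = p.H₂ a := by
  unfold H₃; exact dataMem_of_lt _ _ _ ha

/-- Every cell of `H₃` is below `2 ^ W`. [folklore] -/
theorem H₃_lt (hF : p.Fits W) (halph : ∀ a ∈ p.out', a ∈ TM2Emu.alphabet p.M.tm p.M.tm.k₁) (a : ℕ) : p.H₃ a < 2 ^ W := by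
  obtain ⟨hBv, hSv, hQ, -, -, -, -, -, -, -, -, -, -, -, -, -, hQW, -⟩ := p.facts hF
  have hi : p.i₁ < p.κ := (TM2Emu.enc_good p.M.tm).ι_lt _
  have htop := hF.topTM
  have hγ := hF.gamma
  unfold H₃ dataMem
  split_ifs with h1 h2
  · rw [p.H₂_apply hF]; split_ifs
    · omega
    · have := hF.n_bound; omega
    · exact p.H₁_lt hF a
  · rw [p.stk_halt]
    by_cases hia : a - p.Qtm = p.i₁
    · rw [hia, Function.update_self, List.length_map]
      calc cellAddr p.Qtm p.κ p.i₁ p.out.length ≤ cellAddr p.Qtm p.κ p.κ (max p.hb p.out.length) := by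
            unfold cellAddr; have := Nat.mul_le_mul_left p.κ (le_max_right p.hb p.out.length); omega
        _ < 2 ^ W := htop
    · rw [Function.update_of_ne hia]
      show cellAddr p.Qtm p.κ (a - p.Qtm) 0 < 2 ^ W
      unfold cellAddr; unfold cellAddr at htop; omega
  · rw [p.stk_halt]
    by_cases hia : (a - (p.Qtm + p.κ)) % p.κ = p.i₁
    · rw [hia, Function.update_self]
      unfold stackCell
      split_ifs
      · exact Nat.two_pow_pos W
      · rw [List.getD_eq_getElem?_getD]
        cases hq : (p.out.map fun γ => (TM2Emu.enc p.M.tm).code p.M.tm.k₁ (p.M.outputAlphabet.symm γ)).reverse[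
            (a - (p.Qtm + p.κ)) / p.κ - 1]? with
        | none => simp
        | some v =>
          simp only [Option.getD_some]
          obtain ⟨γ, hγ, rfl⟩ := List.mem_map.1 (List.mem_reverse.1 (List.mem_of_getElem? hq))
          have hmem : p.M.outputAlphabet.symm γ ∈ TM2Emu.alphabet p.M.tm p.M.tm.k₁ :=
            halph _ (by unfold out'; exact List.mem_map.2 ⟨_, hγ, rfl⟩)
          have := (TM2Emu.enc_good p.M.tm).code_le _ _ hmem; omega
    · rw [Function.update_of_ne hia]; simp

/-- **The output symbols lie in the working alphabet** of the output stack (a by-product of the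
simulation certificate `TM2Emu.simProgram_exec`, run here on a synthetic register file). [folklore] -/
theorem out'_mem_alphabet (hF : p.Fits W) (hw : p.φ.IsWidthLE p.k)
    (hrun : Nonempty (TM2OutputsInTime p.M.tm (p.inp hw) (some p.out') p.T')) :
    ∀ a ∈ p.out', a ∈ TM2Emu.alphabet p.M.tm p.M.tm.k₁ := by
  obtain ⟨hBv, hSv, hQ, -, -, -, -, -, -, -, -, -, -, -, -, -, hQW, -, -, hL2, -⟩ := p.facts hF
  have hYlen : p.Y = (p.inp hw).length := p.Y_eq hw
  obtain ⟨-, -, -, halph⟩ := TM2Emu.simProgram_exec p.M.tm hrun (w := W) (O := noOracle)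
    (Q := p.Qtm) (s := 2 * p.L + 101)
    (R := Function.update (Function.update (Function.update (fun _ => 0) 4 p.Qtm) 10 p.Y) 11 p.Bv)
    (H := p.H₂) [] (by omega) (by omega) (by rw [← hYlen]; omega) (by simp)
    (by simp [hYlen]) (by simp; omega)
    (fun t ht => by
      rw [p.H₂_apply hF, if_neg (by omega), if_neg (by omega), p.H₁_string (by rw [hYlen]; exact ht),
        List.getElem_of_eq (p.ys_eq_map_inp hw), List.getElem_map])
    (fun a ha => by rw [p.H₂_apply hF, if_neg (by omega), if_neg (by omega), p.H₁_of_Bv_le (by omega)])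
    (by
      have := hF.topTM
      unfold κ hb at this
      rw [hYlen] at this
      exact lt_of_le_of_lt (cellAddr_le_cellAddr (le_max_left _ _)) this)
    (by have := hF.gamma; omega) hF.key
  exact halph

/-! ### The build parameters are admissible -/

/-- The top of the machine's memory fits. [folklore] -/
theorem bp_top_lt (hF : p.Fits W) : p.bp.bot + p.bp.κ * p.bp.len < 2 ^ W := by
  obtain ⟨-, -, -, -, -, -, -, -, -, -, -, -, -, -, -, -, -, -, flen, fbot⟩ := p.bpf
  have htop := hF.topTM
  rw [fbot, flen]
  show p.Qtm + p.κ + p.i₁ + p.κ * p.out.length < 2 ^ W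
  have hi : p.i₁ < p.κ := (TM2Emu.enc_good p.M.tm).ι_lt _
  unfold cellAddr at htop
  have := Nat.mul_le_mul_left p.κ (le_max_right p.hb p.out.length)
  omega

/-- The region is blank in the base heap. [folklore] -/
theorem bp_base_zero (hF : p.Fits W) (a : ℕ) (h1 : p.bp.Bv ≤ a) (h2 : a < p.bp.rEnd) : p.bp.base a = 0 := by
  obtain ⟨hBv, hSv, hQ, hV1, hV2, hV3, hy, hNd, -⟩ := p.facts hF
  obtain ⟨fBv, fA, fB, fE, -⟩ := p.bpf
  rw [fBv] at h1
  rw [fE] at h2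
  show p.H₃ a = 0
  have haQ : a < p.Qtm := by omega
  have ha1 : a ≠ p.Qtm - 1 := by omega
  have ha2 : a ≠ p.Qtm - 2 := by omega
  rw [p.H₃_of_lt haQ, p.H₂_apply hF, if_neg ha1, if_neg ha2, p.H₁_of_Bv_le h1]

/-- The codes separate the output symbols from all symbols. [folklore] -/
theorem bp_cd_inj (halph : ∀ a ∈ p.out', a ∈ TM2Emu.alphabet p.M.tm p.M.tm.k₁) (s : ℕ) (hs : s < p.out.length)
    (γ : Γ') (h : ocd p.M γ = ocd p.M (p.out[s])) : γ = p.out[s] := by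
  have hmem : p.M.outputAlphabet.symm (p.out[s]) ∈ TM2Emu.alphabet p.M.tm p.M.tm.k₁ :=
    halph _ (by unfold out'; exact List.mem_map.2 ⟨_, List.getElem_mem _, rfl⟩)
  rw [ocd_of_mem _ hmem] at h
  by_cases hmem' : p.M.outputAlphabet.symm γ ∈ TM2Emu.alphabet p.M.tm p.M.tm.k₁
  · rw [ocd_of_mem _ hmem'] at h
    have := (TM2Emu.code_eq_code_iff p.M.tm hmem).1 h
    exact p.M.outputAlphabet.symm.injective this
  · unfold ocd at h
    rw [if_neg hmem'] at h
    have := (TM2Emu.enc_good p.M.tm).code_le _ _ hmem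
    omega

/-- **The side conditions of the build hold** for the parameters of a run, given that the output
symbols lie in the working alphabet (which follows from the machine's run). [folklore] -/
theorem bp_OK (hF : p.Fits W) (halph : ∀ a ∈ p.out', a ∈ TM2Emu.alphabet p.M.tm p.M.tm.k₁) : p.bp.OK W := by
  obtain ⟨hBv, hSv, hQ, hV1, hV2, hV3, hy, hNd, hHd, hN1, hHN, hNNd, hdNd, hd1, hHdNd, hEX, hQW, hPw1, hPw2,
    hL2, hLW, hnW, h1W⟩ := p.facts hF
  obtain ⟨fBv, fA, fB, fE, fy, fN, fd, fNd, fD, fℓ, fhh, fH, fHd, fEX, fQ, fn, fκ, fi, flen, fbot⟩ := p.bpf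
  have hi : p.i₁ < p.κ := (TM2Emu.enc_good p.M.tm).ι_lt _
  have hBv' : 100 ≤ p.bp.Bv := by rw [fBv]; omega
  have hreg : p.bp.rEnd + p.bp.d ≤ p.bp.Qtm := by rw [fE, fd, fQ]; omega
  have hnb : 2 * p.bp.n + 2 < 2 ^ W := by have := hF.n_bound; rw [fn]; omega
  have hEX' : p.bp.EX < p.bp.d := by rw [fEX, fd]; exact hEX
  have h1W' : 1 ≤ W := by have := hF.ws_lt; omega
  exact
    { Bv_ge := hBv'
      region_le := hreg
      i₁_lt := hi
      top_lt := p.bp_top_lt hF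
      base_zero := p.bp_base_zero hF
      base_tape := fun s hs => p.H₃_tape halph s hs
      base_ptr := p.H₃_ptr
      base_lt := fun a _ => p.H₃_lt hF halph a
      cd_inj := p.bp_cd_inj halph
      cd_pos := fun γ => ocd_pos p.M γ
      cd_lt := fun γ => lt_of_le_of_lt (ocd_le p.M γ) hF.gamma
      d_pos := hd1
      N_pos := hN1
      H_eq := rfl
      EX_lt := hEX'
      n_bound := hnb
      one_le_W := h1W' }

/-! ### The small blocks of the build -/

set_option linter.unusedSimpArgs false in
/-- **The glue block** after the transcoder. [folklore] -/
theorem glue_spec (hF : p.Fits W) {R₁ : ℕ → ℕ} (h20 : R₁ 20 = p.Bv) (h21 : R₁ 21 = p.Y) :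
    Achieves W O (block glueOps) (merge R₁ p.H₁) (fun m₂ => m₂ 32 = p.Bv ∧ m₂ 10 = p.Y ∧ m₂ 11 = p.Bv ∧
      m₂ 20 = p.n ∧ ∀ a, 100 ≤ a → m₂ a = p.H₁ a) 8 := by
  obtain ⟨hBv, hSv, hQ, -, -, -, -, -, -, -, -, -, -, -, -, -, hQW, -, -, hL2, -⟩ := p.facts hF
  have hn := p.H₁_n
  refine Achieves.block ?_ le_rfl
  have hLdiv : (p.Bv - p.Y - 101) / 2 + 101 = p.L + 101 := by omega
  have hBY : p.Y ≤ p.Bv := by omega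
  have hBY' : 101 ≤ p.Bv - p.Y := by omega
  have hBvW : p.Bv < 2 ^ W := by omega
  unfold glueOps
  simp (disch := omega) only [execOps_cons, execOps_nil, execOp, Operand.write,
    Operand.read, merge_apply_of_lt, merge_apply_of_le, update_merge_of_lt, Function.update_self, Function.update_of_ne,
    BinOp.eval_add_of_lt, BinOp.eval_sub_of_le, BinOp.eval_div, BinOp.eval_band, Nat.and_self, Nat.add_zero,
    h20, h21, hLdiv, hn]
  refine ⟨?_, ?_, ?_, ?_, fun a ha => ?_⟩
  · simp (disch := omega) only [merge_apply_of_lt, Function.update_self, Function.update_of_ne]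
  · simp (disch := omega) only [merge_apply_of_lt, Function.update_self, Function.update_of_ne]
  · simp (disch := omega) only [merge_apply_of_lt, Function.update_self, Function.update_of_ne]
  · simp (disch := omega) only [merge_apply_of_lt, Function.update_self, Function.update_of_ne]
  · rw [merge_apply_of_le ha]

set_option linter.unusedSimpArgs false in
/-- **The store block**: `n` and `Bv` below the machine's base, `r4 := Qtm`. [folklore] -/
theorem store_spec (hF : p.Fits W) {R : ℕ → ℕ} (q38 : R 38 = p.Qtm) (q20 : R 20 = p.n) (q32 : R 32 = p.Bv)
    (q10 : R 10 = p.Y) (q11 : R 11 = p.Bv) :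
    Achieves W O (block storeOps) (merge R p.H₁) (fun m₄ => m₄ 4 = p.Qtm ∧ m₄ 10 = p.Y ∧ m₄ 11 = p.Bv ∧
      ∀ a, 100 ≤ a → m₄ a = p.H₂ a) 5 := by
  obtain ⟨hBv, hSv, hQ, -, -, -, -, -, -, -, -, -, -, -, -, -, hQW, -, -, hL2, -, hnW, -⟩ := p.facts hF
  refine Achieves.block ?_ le_rfl
  obtain ⟨Q2, hQ2⟩ : ∃ Q2, Q2 = p.Qtm - 2 := ⟨_, rfl⟩
  have hQ2a : 100 ≤ Q2 := by omega
  have hQ2b : Q2 + 3 ≤ 2 ^ W := by omega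
  have hnW' : p.n < 2 ^ W := by omega
  have hBvW : p.Bv < 2 ^ W := by omega
  have hsub : BinOp.eval W .sub p.Qtm 2 = Q2 := by rw [BinOp.eval_sub_of_le (by omega) (by omega), hQ2]
  have hH₂ : p.H₂ = Function.update (Function.update p.H₁ Q2 p.n) (Q2 + 1) p.Bv := by
    have h1 : p.Qtm - 1 = Q2 + 1 := by omega
    unfold H₂; rw [h1, hQ2]
  clear hBv hSv hQ hQW hL2 hnW
  unfold storeOps
  simp (disch := omega) only [execOps_cons, execOps_nil, execOp, Operand.write,
    Operand.read, merge_apply_of_lt, update_merge_of_lt, update_merge_of_le, Function.update_self, Function.update_of_ne,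
    BinOp.eval_add_of_lt, hsub, BinOp.eval_band, Nat.and_self, Nat.add_zero, q38, q20, q32]
  refine ⟨?_, ?_, ?_, fun a ha => ?_⟩
  · simp (disch := omega) only [merge_apply_of_lt, Function.update_self, Function.update_of_ne]
  · simp (disch := omega) only [merge_apply_of_lt, Function.update_self, Function.update_of_ne, q10]
  · simp (disch := omega) only [merge_apply_of_lt, Function.update_self, Function.update_of_ne, q11]
  · rw [merge_apply_of_le ha, hH₂]

set_option linter.unusedSimpArgs false in
/-- **The reload block**: `n` and `Bv` back from below the machine's base. [folklore] -/
theorem reload_spec (hF : p.Fits W) {R₅ : ℕ → ℕ} (h4 : R₅ 4 = p.Qtm) :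
    Achieves W O (block reloadOps) (merge R₅ p.H₃) (fun m₆ => m₆ 20 = p.n ∧ m₆ 32 = p.Bv ∧
      ∀ a, 100 ≤ a → m₆ a = p.H₃ a) 4 := by
  obtain ⟨hBv, hSv, hQ, -, -, -, -, -, -, -, -, -, -, -, -, -, hQW, -, -, hL2, -⟩ := p.facts hF
  refine Achieves.block ?_ le_rfl
  obtain ⟨Q2, hQ2⟩ : ∃ Q2, Q2 = p.Qtm - 2 := ⟨_, rfl⟩
  have hQ2a : 100 ≤ Q2 := by omega
  have hQ2b : Q2 + 3 ≤ 2 ^ W := by omega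
  have hsub : BinOp.eval W .sub p.Qtm 2 = Q2 := by rw [BinOp.eval_sub_of_le (by omega) (by omega), hQ2]
  have hn2 : p.H₃ Q2 = p.n := by
    have h1 : Q2 < p.Qtm := by omega
    have h2 : Q2 ≠ p.Qtm - 1 := by omega
    rw [p.H₃_of_lt h1, p.H₂_apply hF, if_neg h2, if_pos hQ2]
  have hb1 : p.H₃ (Q2 + 1) = p.Bv := by
    have h1 : Q2 + 1 < p.Qtm := by omega
    have h2 : Q2 + 1 = p.Qtm - 1 := by omega
    rw [p.H₃_of_lt h1, p.H₂_apply hF, if_pos h2]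
  clear hBv hSv hQ hQW hL2
  unfold reloadOps
  simp (disch := omega) only [execOps_cons, execOps_nil, execOp, Operand.write,
    Operand.read, merge_apply_of_lt, merge_apply_of_le, update_merge_of_lt, Function.update_self, Function.update_of_ne,
    BinOp.eval_add_of_lt, hsub, BinOp.eval_band, Nat.and_self, h4, hn2, hb1]
  refine ⟨?_, ?_, fun a ha => ?_⟩
  · simp (disch := omega) only [merge_apply_of_lt, Function.update_self, Function.update_of_ne]
  · simp (disch := omega) only [merge_apply_of_lt, Function.update_self, Function.update_of_ne]
  · rw [merge_apply_of_le ha]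

/-- The time of the simulation. [folklore] -/
noncomputable def Tsim : ℕ := TM2Emu.bootCost p.M.tm + 9 * p.Y + p.T' * ((TM2Emu.enc p.M.tm).stepCost p.M.tm.m + 2)

/-- **The simulation step**: from registers `4 = Qtm`, `10 = Y`, `11 = Bv` over the data `H₂`, the
simulation of the sparsifier ends over the data `H₃` with `r4 = Qtm`. [folklore] -/
theorem sim_spec (hF : p.Fits W) (hw : p.φ.IsWidthLE p.k)
    (hrun : Nonempty (TM2OutputsInTime p.M.tm (p.inp hw) (some p.out') p.T')) {R : ℕ → ℕ}
    (s4 : R 4 = p.Qtm) (s10 : R 10 = p.Y) (s11 : R 11 = p.Bv) :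
    Achieves W O (TM2Emu.simProgram p.M.tm) (merge R p.H₂) (fun m₅ => ∃ R₅, m₅ = merge R₅ p.H₃ ∧ R₅ 4 = p.Qtm) p.Tsim := by
  obtain ⟨hBv, hSv, hQ, -, -, -, -, -, -, -, -, -, -, -, -, -, hQW, -, -, hL2, -⟩ := p.facts hF
  have hYlen : p.Y = (p.inp hw).length := p.Y_eq hw
  intro qs
  obtain ⟨R', ⟨t, ht, hex⟩, hR'4, -⟩ := TM2Emu.simProgram_exec p.M.tm hrun (w := W) (O := O)
    (Q := p.Qtm) (s := 2 * p.L + 101) (R := R) (H := p.H₂) qs (by omega) (by omega)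
    (by rw [← hYlen]; omega) s4 (by rw [s10, hYlen]) (by rw [s11, ← hYlen]; omega)
    (fun t ht => by
      rw [p.H₂_apply hF, if_neg (by omega), if_neg (by omega), p.H₁_string (by rw [hYlen]; exact ht),
        List.getElem_of_eq (p.ys_eq_map_inp hw), List.getElem_map])
    (fun a ha => by rw [p.H₂_apply hF, if_neg (by omega), if_neg (by omega), p.H₁_of_Bv_le (by omega)])
    (by
      have := hF.topTM
      unfold κ hb at this
      rw [hYlen] at this
      exact lt_of_le_of_lt (cellAddr_le_cellAddr (le_max_left _ _)) this)
    (by have := hF.gamma; omega) hF.key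
  refine ⟨_, t, ?_, hex, R', rfl, hR'4⟩
  unfold Tsim; rw [hYlen]; exact ht

/-! ### The final memory of the build -/

/-- The clause lists on the tape. [folklore] -/
def F : List (CNF ℕ) := p.Fs.map Prod.snd

/-- **The final memory of the build**: environment registers `Bv, Sv, 0, Pw`, all other registers `0`,
and the intended data of the disjunction on the tape. [folklore] -/
noncomputable def finMem : ℕ → ℕ := fun a =>
  if a < 100 then (if a = 10 then p.Bv else if a = 11 then p.Sv else if a = 13 then p.Pw else 0)
  else p.bp.bheap p.F p.F a

/-- The time of the build. [folklore] -/
noncomputable def Tpre (kw : ℕ) : ℕ :=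
  7 * p.L + (KSatTranscoder.transcodeTime p.φ + (8 + (p.Tsetup + (5 +
    (p.Tsim +
    (4 + (p.Tsetup + (p.bp.Tinit + (p.bp.Tparse kw p.Fs.length + ((2 + ((p.szy * 4 + 1) + ((4 + ((1 + 2) + (1 + ((1 + 2) + (4 + 0))))) + (4 + 0)))) + (96 + 0)))))))))))

set_option linter.unusedSimpArgs false in
/-- **The build.** On the initial memory of `x = encodeCNFWords φ` (word size `W` with `Fits W`), if
the sparsifier outputs `out = sAll Fs` on the input within `T'` steps and the formulas on the tape
respect the bounds of the build (`numVars ≤ n`, at most `D` clauses, variables `< n`, width `≤ kw`,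
`|Fs| · H ≤ N`), then `pre` ends within `Tpre` steps in exactly the memory `finMem`. [folklore] -/
theorem pre_spec (hF : p.Fits W) (hw : p.φ.IsWidthLE p.k)
    (hrun : Nonempty (TM2OutputsInTime p.M.tm (p.inp hw) (some p.out') p.T'))
    (hf1 : ∀ f ∈ p.Fs, f.1 ≤ p.n) (hfD : ∀ f ∈ p.Fs, f.2.length ≤ p.D)
    (hvars : ∀ f ∈ p.Fs, ∀ C ∈ f.2, ∀ l ∈ C, l.1 < p.n) {kw : ℕ} (hkw : ∀ f ∈ p.Fs, ∀ C ∈ f.2, C.length ≤ kw)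
    (hrows : p.Fs.length * p.H ≤ p.N) :
    Achieves W O (pre p.M p.E p.Cs p.c p.kM p.cM) (initFun p.x) (fun m => m = p.finMem) (p.Tpre kw) := by
  obtain ⟨hBv, hSv, hQ, hV1, hV2, hV3, hy, hNd, hHd, hN1, hHN, hNNd, hdNd, hd1, hHdNd, hEX, hQW, hPw1, hPw2,
    hL2, hLW, hnW, h1W⟩ := p.facts hF
  have hgood := TM2Emu.enc_good p.M.tm
  have hxw : ∀ v ∈ p.x, v < 2 ^ W := fun v hv =>
    lt_of_lt_of_le (lt_two_pow_inputWidth_of_mem _ v hv) (Nat.pow_le_pow_right Nat.two_pos hF.width)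
  have hYlen : p.Y = (p.inp hw).length := p.Y_eq hw
  unfold pre Tpre
  -- 1. relocation
  refine Achieves.seqs_cons (R := fun m => m = relocated p.x) (T₁ := 7 * p.L)
    (fun qs => ⟨relocated p.x, 7 * p.L, le_rfl, relocate_exec (by unfold L at hL2; omega) hxw (by unfold L at hLW; omega) qs, rfl⟩) ?_
  rintro m rfl
  -- 2. transcoding
  have hsup : (icodes p.M).sup < 2 ^ W := by
    have h : ∀ γ, icd p.M γ ≤ (TM2Emu.enc p.M.tm).γ := fun γ =>
      hgood.code_le _ _ (TM2Emu.mem_alphabet_k₀ p.M.tm _)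
    have hγ := hF.gamma
    simp only [icodes, KSatTranscoder.Codes.sup]
    have := h (.bit false); have := h (.bit true); have := h .bra; have := h .ket; have := h .comma
    omega
  refine Achieves.seqs_cons (R := fun m₁ => ∃ R₁, m₁ = merge R₁ p.H₁ ∧ R₁ 20 = p.Bv ∧ R₁ 21 = p.Y)
    (T₁ := KSatTranscoder.transcodeTime p.φ) (fun qs => ?_) ?_
  · have hBvW : 2 * p.L + 101 + p.Y < 2 ^ W := by omega
    unfold L Y ys at hBvW
    obtain ⟨R₁, t, hex, ht, h20, h21⟩ := KSatTranscoder.transcode_exec (O := O) (icodes p.M) hsup p.φ hxw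
      hBvW (by unfold L at hLW; exact hLW) qs
    exact ⟨_, t, ht, hex, R₁, rfl, h20, h21⟩
  rintro m₁ ⟨R₁, rfl, h20, h21⟩
  -- 3. glue
  refine Achieves.seqs_cons (p.glue_spec hF h20 h21) ?_
  rintro m₂ ⟨g32, g10, g11, g20, gD⟩
  -- 4. setup
  refine Achieves.seqs_cons (p.setupP_spec hF g20 g32) ?_
  rintro m₃ ⟨hS₃, hlow₃, hD₃⟩
  have q38 : m₃ 38 = p.Qtm := hS₃.1.r38
  have q20 : m₃ 20 = p.n := hS₃.1.r20
  have q32 : m₃ 32 = p.Bv := hS₃.1.r32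
  -- 5. store
  have hm₃ : m₃ = merge m₃ p.H₁ := by
    funext a; by_cases ha : a < 100
    · rw [merge_apply_of_lt ha]
    · rw [merge_apply_of_le (by omega), hD₃ a (by omega), gD a (by omega)]
  rw [hm₃]
  refine Achieves.seqs_cons (p.store_spec hF q38 q20 q32 (by rw [hlow₃ 10 (by omega), g10])
    (by rw [hlow₃ 11 (by omega), g11])) ?_
  rintro m₄ ⟨s4, s10, s11, sD⟩
  -- 6. the simulation
  have hm₄ : m₄ = merge m₄ p.H₂ := by
    funext a; by_cases ha : a < 100
    · rw [merge_apply_of_lt ha]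
    · rw [merge_apply_of_le (by omega), sD a (by omega)]
  rw [hm₄]
  refine Achieves.seqs_cons (p.sim_spec hF hw hrun s4 s10 s11) ?_
  rintro m₅ ⟨R₅, rfl, h4⟩
  -- 7. reload
  refine Achieves.seqs_cons (p.reload_spec hF h4) ?_
  rintro m₆ ⟨u20, u32, uD⟩
  -- 8. setup again
  refine Achieves.seqs_cons (p.setupP_spec hF u20 u32) ?_
  rintro m₇ ⟨hS₇, -, hD₇⟩
  -- 9. the initialisation and 10. the parser
  have hK : p.bp.OK W := p.bp_OK hF (p.out'_mem_alphabet hF hw hrun)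
  refine Achieves.seqs_cons (p.bp.initPhase_spec hK hS₇.1 (fun a ha => by rw [hD₇ a ha, uD a ha]; rfl)) ?_
  rintro m₈ ⟨hB₈, hD₈⟩
  rw [← p.bp_parsePhase]
  refine Achieves.seqs_cons (p.bp.parsePhase_spec hK rfl hf1 hfD hvars hkw hrows hB₈ hD₈) ?_
  rintro m₉ ⟨hB₉, hD₉⟩
  -- 11. the environment registers
  refine Achieves.seqs_cons (p.envPhase_spec hF hB₉) ?_
  rintro mA ⟨e10, e11, e12, e13, eD⟩
  -- 12. clearing the scratch
  refine Achieves.seqs_cons (T₁ := 96) (T₂ := 0) ?_ fun _ h => Achieves.seqs_nil h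
  show Achieves W O (block (CliqueRed.clearedRegs.map fun i => ((.band, CliqueRed.r i, CliqueRed.im 0, CliqueRed.im 0) : OpSpec))) mA _ 96
  refine Achieves.block ?_ (by rw [List.length_map, CliqueRed.length_clearedRegs])
  show execOps W mA (CliqueRed.clearedRegs.map fun i => ((.band, CliqueRed.r i, CliqueRed.im 0, CliqueRed.im 0) : OpSpec)) = p.finMem
  rw [CliqueRed.execOps_clear]
  funext a
  unfold finMem
  simp only [CliqueRed.mem_clearedRegs]
  by_cases ha : a < 100
  · rw [if_pos ha]
    by_cases h10 : a = 10; · subst h10; simp [e10]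
    by_cases h11 : a = 11; · subst h11; simp [e11]
    by_cases h12 : a = 12; · subst h12; simp [e12]
    by_cases h13 : a = 13; · subst h13; simp [e13]
    rw [if_pos ⟨ha, by omega⟩, if_neg h10, if_neg h11, if_neg h13]
  · rw [if_neg (by omega), if_neg ha, eD a (by omega), hD₉ a (by omega)]; rfl

/-! ### The run -/

/-- The emulator environment of the run. [folklore] -/
noncomputable def env : Env := ⟨p.Bv, p.Sv, 0, p.ws, p.V + 1⟩

/-- The emulated input: the word encoding of the OV instance of the disjunction on the tape. [folklore] -/
noncomputable def y : List ℕ := OVInstance.encode (ovInst p.F p.hh p.H p.D p.ℓ p.N p.d)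

/-- The emulator's side conditions hold. [folklore] -/
theorem envOK (hF : p.Fits W) : EnvOK lay p.env W := by
  obtain ⟨hBv, hSv, hQ, hV1, hV2, hV3, hy, hNd, hHd, hN1, hHN, hNNd, hdNd, hd1, hHdNd, hEX, hQW, -⟩ := p.facts hF
  refine ⟨by decide, by decide, by decide, by decide, by decide, by decide, by decide,
    fun r hr => ?_, Or.inl ?_, ?_, ?_, hF.ws_lt.le⟩
  · simp only [lay, Layout.regs, List.mem_cons, List.not_mem_nil, or_false] at hr
    show r < p.Bv ∧ r < p.Sv
    rcases hr with rfl | rfl | rfl | rfl | rfl | rfl | rfl <;> omega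
  · show p.Bv + (p.V + 1) ≤ p.Sv; omega
  · show p.Bv + (p.V + 1) ≤ 2 ^ W; omega
  · show p.Sv + (p.V + 1) ≤ 2 ^ W; omega

/-- Every cell of the final memory is below `2 ^ W`. [folklore] -/
theorem finMem_lt (hF : p.Fits W) (hK : p.bp.OK W) (a : ℕ) : p.finMem a < 2 ^ W := by
  obtain ⟨hBv, hSv, hQ, hV1, hV2, hV3, hy, hNd, hHd, hN1, hHN, hNNd, hdNd, hd1, hHdNd, hEX, hQW, hPw1, hPw2, -⟩ :=
    p.facts hF
  unfold finMem
  by_cases ha : a < 100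
  · rw [if_pos ha]; split_ifs <;> omega
  · rw [if_neg ha]; exact p.bp.bheap_lt hK _ _ (by omega)

/-- **The target invariant at the end of the build.** [folklore] -/
theorem tinv_finMem (hF : p.Fits W) (hK : p.bp.OK W) : TInv lay p.env (2 ^ W - 1) p.finMem := by
  obtain ⟨hBv, hSv, hQ, hV1, hV2, hV3, hy, hNd, -⟩ := p.facts hF
  obtain ⟨fBv, fA, fB, fE, -⟩ := p.bpf
  refine ⟨⟨?_, ?_, ?_, ?_⟩, fun a ha => ?_, fun a => Nat.le_sub_one_of_lt (p.finMem_lt hF hK a)⟩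
  · show p.finMem 10 = p.Bv; simp [finMem]
  · show p.finMem 11 = p.Sv; simp [finMem]
  · show p.finMem 12 = 0; simp [finMem]
  · show p.finMem 13 = 2 ^ p.ws; simp [finMem]; rfl
  · change a < p.V + 1 at ha
    show p.finMem (p.Sv + a) ≤ 0
    unfold finMem
    rw [if_neg (by omega), p.bp.bheap_of_not_region _ _ (Or.inr (by rw [fE]; omega))]
    show p.H₃ (p.Sv + a) ≤ 0
    rw [p.H₃_of_lt (by omega), p.H₂_apply hF, if_neg (by omega), if_neg (by omega), p.H₁_of_Bv_le (by omega)]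

/-- The length of the emulated input. [folklore] -/
theorem length_y : p.y.length = p.ylen := by
  unfold y ylen Nd; rw [length_encode_ovInst]

/-- **The width of the emulated input is `size |y|`** (every word is at most `|y|`). [folklore] -/
theorem inputWidth_y : inputWidth p.y = p.szy := by
  obtain ⟨-, -, hN1, -, hd1, -⟩ := p.small_facts
  have hlen := p.length_y
  have hall : ∀ v ∈ p.y, v ≤ p.ylen := fun v hv => by
    obtain ⟨t, ht, rfl⟩ := List.getElem_of_mem hv
    unfold y at ht ⊢
    rw [getElem_encode_ovInst _ _ _ _ _ _ _ ht]
    refine le_trans (ycell_le _ _ _ _ _ _ _ t) ?_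
    unfold ylen Nd
    have : p.N ≤ p.N * p.d := Nat.le_mul_of_pos_right _ hd1
    have : p.d ≤ p.N * p.d := Nat.le_mul_of_pos_left _ hN1
    omega
  have h1 : 1 ≤ p.ylen := by unfold ylen; omega
  have key : ∀ l : List ℕ, (∀ v ∈ l, v ≤ p.ylen) → l.foldr max 1 ≤ p.ylen := by
    intro l hl
    induction l with
    | nil => simpa using h1
    | cons v l ih =>
      rw [List.foldr_cons]
      exact max_le (hl v (by simp)) (ih fun w hw => hl w (by simp [hw]))
  have hmax : p.y.foldr max 1 ≤ p.ylen := key _ hall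
  unfold inputWidth szy
  rw [hlen, max_eq_left hmax]

/-- The emulated input's width is at most the emulated word size (for `kM ≥ 1`). [folklore] -/
theorem inputWidth_y_le (hk : 1 ≤ p.kM) : inputWidth p.y ≤ p.ws := by
  rw [p.inputWidth_y]; unfold ws
  calc p.szy = p.szy * 1 := (Nat.mul_one _).symm
    _ ≤ p.szy * p.kM := Nat.mul_le_mul_left _ hk

/-- **The emulated input is in place at the end of the build** (for `kM ≥ 1`). [folklore] -/
theorem agree_finMem (hF : p.Fits W) (hK : p.bp.OK W) (hk : 1 ≤ p.kM) : Agree p.env p.finMem (init p.ws p.y).mem := by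
  obtain ⟨hBv, hSv, hQ, hV1, hV2, hV3, hy, hNd, -, hN1, -, -, -, hd1, -⟩ := p.facts hF
  obtain ⟨fBv, fA, fB, fE, fy, fN, fd, fNd, fD, fℓ, fhh, fH, fHd, fEX, fQ, fn, -⟩ := p.bpf
  rw [init_mem_eq_initFun (p.inputWidth_y_le hk)]
  have hlen := p.length_y
  intro a ha
  change a < p.V + 1 at ha
  have hstamp : p.finMem (p.Sv + a) = 0 := Nat.le_zero.1 ((p.tinv_finMem hF hK).stamp a ha)
  show (if p.finMem (p.Sv + a) = 0 then p.finMem (p.Bv + a) else 0) = initFun p.y a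
  rw [if_pos hstamp]
  unfold finMem initFun
  rw [if_neg (by omega)]
  rcases Nat.eq_zero_or_pos a with rfl | hpos
  · rw [if_pos rfl, hlen, Nat.add_zero]; unfold BP.bheap; rw [if_pos fBv.symm, fy]
  rw [if_neg (by omega)]
  by_cases hin : a - 1 < p.y.length
  · rw [List.getD_eq_getElem _ _ hin]
    unfold y at hin ⊢
    rw [getElem_encode_ovInst _ _ _ _ _ _ _ hin]
    rw [length_encode_ovInst] at hin
    unfold ycell BP.bheap
    show (if p.Bv + a = p.Bv then _ else if p.Bv + a = p.Bv + 1 then p.N else if p.Bv + a = p.Bv + 2 then p.d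
      else if p.Bv + 3 ≤ p.Bv + a ∧ p.Bv + a < p.Bv + 3 + p.N * p.d then
        (uCoord (p.F) p.hh p.H p.D p.ℓ ((p.Bv + a - (p.Bv + 3)) / p.d) ((p.Bv + a - (p.Bv + 3)) % p.d)).toNat
      else if p.Bv + 3 + p.N * p.d ≤ p.Bv + a ∧ p.Bv + a < p.Bv + 3 + p.N * p.d + p.N * p.d then
        (vCoord (p.F) p.hh p.H p.D p.ℓ ((p.Bv + a - (p.Bv + 3 + p.N * p.d)) / p.d) ((p.Bv + a - (p.Bv + 3 + p.N * p.d)) % p.d)).toNat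
      else p.H₃ (p.Bv + a)) = _
    rw [if_neg (by omega)]
    by_cases h1 : a - 1 = 0
    · rw [if_pos (by omega), if_pos h1]
    rw [if_neg (by omega), if_neg h1]
    by_cases h2 : a - 1 = 1
    · rw [if_pos (by omega), if_pos h2]
    rw [if_neg (by omega), if_neg h2]
    by_cases h3 : a - 1 < 2 + p.N * p.d
    · rw [if_pos ⟨by omega, by omega⟩, if_pos h3, show p.Bv + a - (p.Bv + 3) = a - 1 - 2 by omega]
    · rw [if_neg (by omega), if_neg h3, if_pos ⟨by omega, by omega⟩,
        show p.Bv + a - (p.Bv + 3 + p.N * p.d) = a - 1 - 2 - p.N * p.d by omega]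
  · rw [List.getD_eq_default _ _ (Nat.not_lt.1 hin)]
    rw [hlen] at hin
    unfold BP.bheap
    rw [if_neg (by omega), if_neg (by omega), if_neg (by omega), if_neg (by show ¬ (p.Bv + 3 ≤ _ ∧ _ < p.Bv + 3 + p.N * p.d); omega),
      if_neg (by show ¬ (p.Bv + 3 + p.N * p.d ≤ _ ∧ _ < p.Bv + 3 + p.N * p.d + p.N * p.d); omega)]
    show p.H₃ (p.Bv + a) = 0
    rw [p.H₃_of_lt (by omega), p.H₂_apply hF, if_neg (by omega), if_neg (by omega), p.H₁_of_Bv_le (by omega)]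

/-- **The read-out.** From any memory agreeing with the halting memory `dm` of the OV program (target
invariant kept), `CliqueRed.post` outputs `[dm 1]` in `3` steps. [folklore] -/
theorem post_spec (hF : p.Fits W) {m₂ dm : ℕ → ℕ} (hag : Agree p.env m₂ dm)
    (hI : TInv lay p.env (2 ^ W - 1) m₂) (qs : List (List ℕ)) :
    ∃ (st₃ : Store) (t₃ : ℕ), t₃ ≤ 3 ∧ Exec W O CliqueRed.post ⟨m₂, qs⟩ st₃ t₃ ∧ readOut st₃.mem = [dm 1] := by
  obtain ⟨hBv, hSv, hQ, hV1, hV2, hV3, hy, hNd, -, -, -, -, -, -, -, -, hQW, -⟩ := p.facts hF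
  have h10 : m₂ 10 = p.Bv := hI.env.1
  have hst : m₂ (p.Sv + 1) = 0 := Nat.le_zero.1 (hI.stamp 1 (by show 1 < p.V + 1; omega))
  have h1 : m₂ (p.Bv + 1) = dm 1 := by
    have := hag 1 (by show 1 < p.V + 1; omega)
    simp only [edec, Params.env, hst, if_true] at this
    exact this
  refine ⟨_, 3, le_rfl, Exec.block _ m₂ qs, ?_⟩
  have hm : execOps W m₂ [(.add, r 17, r 10, im 1), (.band, r 1, pt 17, pt 17), (.band, r 0, im 1, im 1)] =
      Function.update (Function.update (Function.update m₂ 17 (p.Bv + 1)) 1 (dm 1)) 0 1 := by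
    simp (disch := first | omega | decide) only [execOps_cons, execOps_nil, execOp, Operand.write,
      Operand.read, Function.update_self, Function.update_of_ne, h10, BinOp.eval_add_of_lt,
      BinOp.eval_band, Nat.and_self]
    rw [h1]
  show readOut (execOps W m₂ _) = _
  rw [hm]
  simp [readOut, readSeg, Function.update_self, Function.update_of_ne]

/-- The total time of the program, given a time bound `T` for the OV program. [folklore] -/
noncomputable def Ttotal (kw T : ℕ) : ℕ := p.Tpre kw + cstep * T + 4

/-- **The program's output.** At a word size `W` with `Fits W` (and `kM ≥ 1`), if the sparsifier runs as
assumed and the formulas on the tape respect the bounds, and the deterministic oracle-free OV program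
`Mov` (largest constant `cM`) outputs `[bit]` on the emulated input `y` at word size `ws` within `T`
steps, then the program outputs `[bit]` on `x` within `Tpre + 38 T + 4` steps. [folklore] -/
theorem reduction_outputsWithin (hF : p.Fits W) (hk : 1 ≤ p.kM) (hw : p.φ.IsWidthLE p.k)
    (hrun : Nonempty (TM2OutputsInTime p.M.tm (p.inp hw) (some p.out') p.T'))
    (hf1 : ∀ f ∈ p.Fs, f.1 ≤ p.n) (hfD : ∀ f ∈ p.Fs, f.2.length ≤ p.D)
    (hvars : ∀ f ∈ p.Fs, ∀ C ∈ f.2, ∀ l ∈ C, l.1 < p.n) {kw : ℕ} (hkw : ∀ f ∈ p.Fs, ∀ C ∈ f.2, C.length ≤ kw)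
    (hrows : p.Fs.length * p.H ≤ p.N)
    {Mov : Program} (hdet : Mov.IsDeterministic) (hof : Mov.IsOracleFree) (hcM : Mov.maxConst = p.cM)
    {T bit : ℕ} (hM : OutputsWithin Mov p.ws noOracle zeroCoins p.y [bit] T) :
    OutputsWithin (reduction p.M Mov p.E p.Cs p.c p.kM) W noOracle zeroCoins p.x [bit] (p.Ttotal kw T) := by
  obtain ⟨hBv, hSv, hQ, hV1, hV2, hV3, hy, hNd, hHd, hN1, hHN, hNNd, hdNd, hd1, hHdNd, hEX, hQW, hPw1, hPw2,
    hL2, hLW, hnW, h1W⟩ := p.facts hF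
  have hK : p.bp.OK W := p.bp_OK hF (p.out'_mem_alphabet hF hw hrun)
  have hW1 : 1 ≤ W := by have := hF.ws_lt; omega
  obtain ⟨st₁, t₁, ht₁, hexec, hmem, hqs⟩ :=
    (p.pre_spec (O := noOracle) hF hw hrun hf1 hfD hvars hkw hrows).exists_exec
  obtain ⟨dh, hhalt, hout⟩ := (outputsWithin_iff_exists_haltsWithin _ _ _ _ _ _ _).1 hM
  have hst₁ : st₁ = ⟨p.finMem, []⟩ := by cases st₁; simp only at hmem hqs; rw [hmem, hqs]
  subst hst₁
  unfold reduction
  rw [hcM]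
  have key := outputsWithin_withSubrun (O := noOracle) zeroCoins (pre := pre p.M p.E p.Cs p.c p.kM p.cM)
    (post := CliqueRed.post) (L := lay) (E := p.env) (VT := 2 ^ W - 1) (V := p.V) (M := Mov) (x := p.x)
    (y := p.y) (out := [bit]) (T₂ := 3) hF.width hexec (p.envOK hF) (by omega) (by omega)
    (fun r hr => by
      simp only [lay, Layout.regs, List.mem_cons, List.not_mem_nil, or_false] at hr
      rcases hr with rfl | rfl | rfl | rfl | rfl | rfl | rfl <;> omega)
    hdet hof (by rw [hcM]; exact hV2) (by show p.V < p.V + 1; omega) (by omega)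
    (by show 2 ^ p.ws - 1 ≤ p.V; exact hV1) (by omega)
    (p.tinv_finMem hF hK) (p.agree_finMem hF hK hk) hhalt
    (fun m₂ hag hI _ => by
      have := p.post_spec (O := noOracle) hF hag hI []
      rwa [CliqueRed.mem_one_of_readOut hout] at this)
  exact key.mono (by unfold Ttotal; omega)

end Params

end Literature.Computability.FineGrained.OVRed.Single
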